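import Literature.Analysis.FluidPDE.TaoY6WhitneyToolkit
import Literature.Analysis.FluidPDE.TaoNonlinearEstimate
import Literature.Analysis.FluidPDE.TaoEnstrophyExteriorLeaves
import HarnessLib

/-!
# Tao (2011/2013), proof of Thm. 10.1: the `Y₆` estimate summed over a discrete Whitney family,
# and the discharge of `tao2011_nonlinearEstimate` (hence of the a priori Thm. 10.1)

Final file of the discharge of `tao2011_nonlinearEstimate` (T. Tao, *Localisation and
compactness properties of the Navier–Stokes global regularity problem*, arXiv:1108.1165, §10,
proof of Thm. 10.1, pp. 32–33: the estimates (10.19)–(10.24) for the nonlinear term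
`Y₆ = ∫ O(ωω∇u)η`). On a discrete Whitney family of the annulus (`TaoWhitneyCover`,
`TaoY6WhitneyToolkit`) we sum the single-ball estimates and run the parent-ball chaining of
`TaoWhitneyChaining` for the lower-order term, arriving at the **generic-slope form of Tao's bound**

  `∫ |ω|²‖Du‖η ≤ K₀ (k^{3/2} 𝒲^{1/2}𝒲 + k^{-1/2} 𝒲^{1/2}𝒴 + k^{5/2}‖u‖_{L²}𝒲 + k s ∫_{layers}|ω|²)`

(`Y6.lintegral_Y6_le`; `𝒲 = ∫|ω|²η`, `𝒴 = ∫‖∇ω‖²η`, `η = annularRamp k a b |· − x₀|`; Tao: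
"`Y₆,₁ ≲ c^{-0.15}δ³W^{3/2} + c^{0.05}δ⁻¹W^{1/2}Y₁`", "`Y₆,₂ ≲ c^{0.9}Y₂ + c^{0.75}W/T`"), and then
at the **named fact itself** by the substitution `k = c^{-1/10}δ²`, the smallness (10.2)
`δ⁵E^{1/2}T ≤ c` and `c ≤ c^{9/10}`:

* `tao2011_nonlinearEstimate_holds : tao2011_nonlinearEstimate` (`TaoNonlinearEstimate.lean`);
* consequently, through the tree's assemblies (`TaoAnnulusAssembly`, `TaoEnstrophyExteriorLeaves`),
  **Tao's Thm. 10.1 in the a priori exterior form is a theorem**: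
  `tao2011_enstrophyLocalisation_exterior_apriori_holds`, and so is the exterior form of Thm. 10.1
  itself, `tao2011_enstrophyLocalisation_exterior_holds` (Prop. 9.1 having been discharged in
  `TaoBoundedTotalSpeedProofs`).

Steps (all `ℝ≥0∞`-valued): `Y6.setLIntegral_nineBall_le`/`Y6.rms_le` ((10.22)–(10.23) on one
ball via the overlap bound), `Y6.big_ball_rms_le` (large balls), `Y6.small_ball_chainStep_le`
((10.23) once and (10.24) twice), `Y6.tsum_pow_four_rms_le` (the chained sum `Σ rᵢ⁴wᵢ³`),
`Y6.term1a_le`, `Y6.term1_le` ((10.21)), `Y6.term2_small_le`/`Y6.term2_big_le` (the two cases of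
`Y₆,₂`), the assembly `Y6.lintegral_Y6_le`, and the substitution
`Y6.exists_tao2011_nonlinearEstimateWith`. No statement of the tree is modified; no definition is
introduced. (Parallel routes to the same step exist in the tree through the continuous Whitney
decomposition — `TaoWhitneyKernel`, `TaoRayChain`, `TaoY6BallEstimate`, `DyadicChaining` —; this
file records the discrete-family route.)

## References

* T. Tao, *Localisation and compactness properties of the Navier–Stokes global regularity
  problem*, Anal. PDE 6 (2013) 25–107 = arXiv:1108.1165 (`Tao2011`), §10, proof of Thm. 10.1,
  pp. 32–33 ((10.19)–(10.24)), Remark 10.6.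
-/

noncomputable section

open MeasureTheory Set Metric Filter Function
open scoped ENNReal NNReal Topology

namespace Literature.Analysis.FluidPDE

namespace Y6

/-- Local notation for physical space. -/
local notation "ℝ³" => EuclideanSpace ℝ (Fin 3)

/-! ## The summation over the Whitney family -/

section Main

variable {x₀ : ℝ³} {a b k : ℝ}

/-- Overlap constant `(16M+4)³` of `TaoWhitneyCover` in dimension `3`. [folklore] -/
theorem tsum_setLIntegral_whitneyBall_le {S : Set ℝ³}
    (hW : IsWhitneyFamily (whitneyRadius x₀ a b k) {x | 0 < annDepth x₀ a b x} S) (hk : 0 < k)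
    {M : ℝ} (hM0 : 0 ≤ M) (hM : M ≤ 50) {f : ℝ³ → ℝ≥0∞} (hf : AEMeasurable f volume) :
    ∑' x : S, ∫⁻ y in ball (x : ℝ³) (M * whitneyRadius x₀ a b k x), f y ≤
      ENNReal.ofReal ((16 * M + 4) ^ 3) * ∫⁻ y, f y := by
  have hL : LipschitzWith (1 / 100 : ℝ≥0) (whitneyRadius x₀ a b k) :=
    LipschitzWith.of_dist_le_mul fun x y => by
      rw [Real.dist_eq, dist_eq_norm]
      push_cast
      have := abs_whitneyRadius_sub_le x₀ a b k x y
      linarith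
  have hML : M * ((1 / 100 : ℝ≥0) : ℝ) ≤ 1 / 2 := by push_cast; linarith
  have h := tsum_setLIntegral_ball_le (E := ℝ³) volume hL hM0 hML hW.countable hW.disjoint
    (fun x hx => whitneyRadius_pos hk (hW.subset hx)) hf
  rw [finrank_euclideanSpace_fin] at h
  exact h.trans (mul_le_mul' le_rfl (lintegral_mono_set (subset_univ _) |>.trans (le_of_eq
    (Measure.restrict_univ ▸ rfl))))


/-! ### Single-ball consequences of the localised enstrophy bound, (10.22)–(10.23) -/

/-- **(10.22)–(10.23) on one ball**: `91 k ρ(x) ∫_{B(x,9ρ(x))} |ω|² ≤ ∫_{B(x,9ρ(x))} |ω|² η`, hence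
with the overlap bound `∫_{B(x,9ρ)}|ω|² ≤ (91kρ(x))⁻¹ · 148³ 𝒲`, `𝒲 = ∫|ω|²η` (Tao:
"`wᵢ ≲ c^{0.05}δ⁻¹W^{1/2}rᵢ⁻²`"). [cite: Tao2011, §10, proof of Thm. 10.1 ((10.22)–(10.23))] -/
theorem setLIntegral_nineBall_le {S : Set ℝ³}
    (hW : IsWhitneyFamily (whitneyRadius x₀ a b k) {x | 0 < annDepth x₀ a b x} S) (hk : 0 < k)
    {ω : ℝ³ → ℝ³} (hω : Continuous ω) {x : ℝ³} (hxS : x ∈ S) :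
    ∫⁻ y in ball x (9 * whitneyRadius x₀ a b k x), ‖ω y‖ₑ ^ 2 ≤
      ENNReal.ofReal ((91 * k * whitneyRadius x₀ a b k x)⁻¹) * (ENNReal.ofReal (148 ^ 3) *
        ∫⁻ y, ‖ω y‖ₑ ^ 2 * ENNReal.ofReal (annularRamp k a b ‖y - x₀‖)) := by
  have hx : 0 < annDepth x₀ a b x := hW.subset hxS
  have hρ : 0 < whitneyRadius x₀ a b k x := whitneyRadius_pos hk hx
  have hc : 0 < 91 * k * whitneyRadius x₀ a b k x := by positivity
  have h1 := ofReal_mul_setLIntegral_le_setLIntegral_mul_annularRamp (M := 9) hk hx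
    (fun y => ‖ω y‖ₑ ^ 2)
  rw [show (100 - 9 : ℝ) = 91 by norm_num] at h1
  have hmeas : AEMeasurable (fun y => ‖ω y‖ₑ ^ 2 * ENNReal.ofReal (annularRamp k a b ‖y - x₀‖)) volume :=
    (hω.aemeasurable.enorm.pow_const 2).mul (ENNReal.measurable_ofReal.comp_aemeasurable
      (((continuous_annularRamp hk.le a b).comp (continuous_id.sub continuous_const).norm).aemeasurable))
  have h2 := tsum_setLIntegral_whitneyBall_le hW hk (by norm_num : (0:ℝ) ≤ 9) (by norm_num) hmeas
  have h3 : ∫⁻ y in ball x (9 * whitneyRadius x₀ a b k x), ‖ω y‖ₑ ^ 2 *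
      ENNReal.ofReal (annularRamp k a b ‖y - x₀‖) ≤ ENNReal.ofReal (148 ^ 3) *
        ∫⁻ y, ‖ω y‖ₑ ^ 2 * ENNReal.ofReal (annularRamp k a b ‖y - x₀‖) := by
    refine le_trans ?_ (h2.trans (le_of_eq (by norm_num)))
    exact ENNReal.le_tsum (⟨x, hxS⟩ : S)
  calc ∫⁻ y in ball x (9 * whitneyRadius x₀ a b k x), ‖ω y‖ₑ ^ 2
      = ENNReal.ofReal ((91 * k * whitneyRadius x₀ a b k x)⁻¹) *
          (ENNReal.ofReal (91 * k * whitneyRadius x₀ a b k x) *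
            ∫⁻ y in ball x (9 * whitneyRadius x₀ a b k x), ‖ω y‖ₑ ^ 2) := by
        rw [← mul_assoc, ← ENNReal.ofReal_mul (inv_nonneg.2 hc.le), inv_mul_cancel₀ hc.ne',
          ENNReal.ofReal_one, one_mul]
    _ ≤ ENNReal.ofReal ((91 * k * whitneyRadius x₀ a b k x)⁻¹) * (ENNReal.ofReal (148 ^ 3) *
        ∫⁻ y, ‖ω y‖ₑ ^ 2 * ENNReal.ofReal (annularRamp k a b ‖y - x₀‖)) :=
        mul_le_mul' le_rfl (h1.trans h3)

/-- **The root-mean-square bound (10.23)**: `m(x) ≤ (91k)^{-1/2} 148^{3/2} 𝒲^{1/2} ρ(x)⁻²` for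
centres of the family. [cite: Tao2011, §10, proof of Thm. 10.1 ((10.23))] -/
theorem rms_le {S : Set ℝ³}
    (hW : IsWhitneyFamily (whitneyRadius x₀ a b k) {x | 0 < annDepth x₀ a b x} S) (hk : 0 < k)
    {ω : ℝ³ → ℝ³} (hω : Continuous ω) {x : ℝ³} (hxS : x ∈ S) :
    rms ω x (whitneyRadius x₀ a b k x) ≤
      ENNReal.ofReal ((91 * k)⁻¹ ^ (1 / 2 : ℝ) * (whitneyRadius x₀ a b k x) ^ (-(2 : ℝ))) *
        (ENNReal.ofReal (148 ^ 3) * ∫⁻ y, ‖ω y‖ₑ ^ 2 * ENNReal.ofReal (annularRamp k a b ‖y - x₀‖)) ^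
          (1 / 2 : ℝ) := by
  have hx : 0 < annDepth x₀ a b x := hW.subset hxS
  have hρ : 0 < whitneyRadius x₀ a b k x := whitneyRadius_pos hk hx
  set r := whitneyRadius x₀ a b k x with hr
  have h := setLIntegral_nineBall_le hW hk hω hxS
  rw [rms_def]
  calc (∫⁻ y in ball x (9 * r), ‖ω y‖ₑ ^ 2) ^ (1 / 2 : ℝ) * ENNReal.ofReal (r ^ (-(3 / 2) : ℝ))
      ≤ (ENNReal.ofReal ((91 * k * r)⁻¹) * (ENNReal.ofReal (148 ^ 3) *
          ∫⁻ y, ‖ω y‖ₑ ^ 2 * ENNReal.ofReal (annularRamp k a b ‖y - x₀‖))) ^ (1 / 2 : ℝ) *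
          ENNReal.ofReal (r ^ (-(3 / 2) : ℝ)) :=
        mul_le_mul' (ENNReal.rpow_le_rpow h (by norm_num)) le_rfl
    _ = _ := by
        rw [ENNReal.mul_rpow_of_nonneg _ _ (by norm_num : (0 : ℝ) ≤ 1 / 2),
          ENNReal.ofReal_rpow_of_nonneg (by positivity) (by norm_num)]
        have key : ENNReal.ofReal (r ^ (-(3 / 2) : ℝ)) * ENNReal.ofReal ((91 * k * r)⁻¹ ^ (1 / 2 : ℝ)) =
            ENNReal.ofReal ((91 * k)⁻¹ ^ (1 / 2 : ℝ) * r ^ (-(2 : ℝ))) := by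
          rw [← ENNReal.ofReal_mul (Real.rpow_nonneg hρ.le _)]
          congr 1
          have hk0 : (0 : ℝ) ≤ (91 * k)⁻¹ := by positivity
          rw [mul_inv, Real.mul_rpow hk0 (inv_nonneg.2 hρ.le), Real.inv_rpow hρ.le,
            ← Real.rpow_neg hρ.le]
          calc r ^ (-(3 / 2) : ℝ) * ((91 * k)⁻¹ ^ (1 / 2 : ℝ) * r ^ (-(1 / 2) : ℝ))
              = (91 * k)⁻¹ ^ (1 / 2 : ℝ) * (r ^ (-(3 / 2) : ℝ) * r ^ (-(1 / 2) : ℝ)) := by ring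
            _ = (91 * k)⁻¹ ^ (1 / 2 : ℝ) * r ^ (-(2 : ℝ)) := by
                rw [← Real.rpow_add hρ]; norm_num
        set X := (ENNReal.ofReal (148 ^ 3) *
          ∫⁻ y, ‖ω y‖ₑ ^ 2 * ENNReal.ofReal (annularRamp k a b ‖y - x₀‖)) ^ (1 / 2 : ℝ)
        calc ENNReal.ofReal ((91 * k * r)⁻¹ ^ (1 / 2 : ℝ)) * X * ENNReal.ofReal (r ^ (-(3 / 2) : ℝ))
            = (ENNReal.ofReal (r ^ (-(3 / 2) : ℝ)) * ENNReal.ofReal ((91 * k * r)⁻¹ ^ (1 / 2 : ℝ))) * X := by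
              ring
          _ = _ := by rw [key]


/-- `ρ⁴ m³ = ρ · A · m` where `m = A^{1/2} ρ^{-3/2}` is the root-mean-square on `B(x, 9ρ)`. [folklore] -/
theorem ofReal_pow_four_mul_rms_pow_three {ω : ℝ³ → ℝ³} {x : ℝ³} {r : ℝ} (hr : 0 < r) :
    ENNReal.ofReal (r ^ 4) * rms ω x r ^ 3 =
      ENNReal.ofReal r * (∫⁻ y in ball x (9 * r), ‖ω y‖ₑ ^ 2) * rms ω x r := by
  have rpow_half_sq : ∀ A : ℝ≥0∞, (A ^ (1 / 2 : ℝ)) ^ 2 = A := fun A => by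
    simpa [one_div] using ENNReal.rpow_inv_natCast_pow two_ne_zero A
  have h2 : rms ω x r ^ 2 = (∫⁻ y in ball x (9 * r), ‖ω y‖ₑ ^ 2) * ENNReal.ofReal (r ^ (-(3 : ℝ))) := by
    rw [rms_def, mul_pow, rpow_half_sq, ← ENNReal.ofReal_pow (Real.rpow_nonneg hr.le _),
      ← Real.rpow_natCast, ← Real.rpow_mul hr.le]
    norm_num
  have h4 : ENNReal.ofReal (r ^ 4) * ENNReal.ofReal (r ^ (-(3 : ℝ))) = ENNReal.ofReal r := by
    rw [← ENNReal.ofReal_mul (by positivity), show r ^ 4 = r ^ (4 : ℝ) by norm_cast,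
      ← Real.rpow_add hr]
    norm_num
  calc ENNReal.ofReal (r ^ 4) * rms ω x r ^ 3 = ENNReal.ofReal (r ^ 4) * (rms ω x r ^ 2 * rms ω x r) := by
        rw [← pow_succ (rms ω x r) 2]
    _ = ENNReal.ofReal (r ^ 4) * ENNReal.ofReal (r ^ (-(3 : ℝ))) *
        (∫⁻ y in ball x (9 * r), ‖ω y‖ₑ ^ 2) * rms ω x r := by rw [h2]; ring
    _ = _ := by rw [h4]

/-- **A big ball's contribution to the lower-order term**: for a centre `z` of the family with
`d(z) ≥ 0.9k⁻¹`, `ρ(z)⁴ m(z)³ ≤ C k^{1/2} 𝒲ₜ^{1/2} ∫_{B(z,9ρ)}|ω|²η`, `C = 91^{-1/2}/(0.819 · 0.009)`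
(Tao: "`c^{-0.1}δ² Σᵢ rᵢ⁴w_{a(i)}³ ≲ … ≲ c^{-0.15}δ³W^{3/2}`"). [cite: Tao2011, §10, proof of Thm. 10.1 (large balls, p. 33)] -/
theorem big_ball_rms_le {S : Set ℝ³}
    (hW : IsWhitneyFamily (whitneyRadius x₀ a b k) {x | 0 < annDepth x₀ a b x} S) (hk : 0 < k)
    {ω : ℝ³ → ℝ³} (hω : Continuous ω) {z : ℝ³} (hzS : z ∈ S) (hbig : 0.9 * k⁻¹ ≤ annDepth x₀ a b z) :
    ENNReal.ofReal (whitneyRadius x₀ a b k z ^ 4) * rms ω z (whitneyRadius x₀ a b k z) ^ 3 ≤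
      ENNReal.ofReal ((91 : ℝ)⁻¹ ^ (1 / 2 : ℝ) / (0.819 * 0.009) * k ^ (1 / 2 : ℝ)) *
        (ENNReal.ofReal (148 ^ 3) * ∫⁻ y, ‖ω y‖ₑ ^ 2 * ENNReal.ofReal (annularRamp k a b ‖y - x₀‖)) ^
          (1 / 2 : ℝ) *
        ∫⁻ y in ball z (9 * whitneyRadius x₀ a b k z), ‖ω y‖ₑ ^ 2 *
          ENNReal.ofReal (annularRamp k a b ‖y - x₀‖) := by
  have hz : 0 < annDepth x₀ a b z := hW.subset hzS
  set r := whitneyRadius x₀ a b k z with hr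
  have hρ : 0 < r := whitneyRadius_pos hk hz
  have hrk : 0.9 * k⁻¹ / 100 ≤ r := le_whitneyRadius_of_le hk hbig
  have hkr : 0.009 ≤ k * r := by
    have := mul_le_mul_of_nonneg_left hrk hk.le
    rw [show k * (0.9 * k⁻¹ / 100) = 0.009 * (k * k⁻¹) by ring, mul_inv_cancel₀ hk.ne', mul_one] at this
    exact this
  set 𝒲ₜ := ENNReal.ofReal (148 ^ 3) * ∫⁻ y, ‖ω y‖ₑ ^ 2 * ENNReal.ofReal (annularRamp k a b ‖y - x₀‖)
    with h𝒲
  set Aη := ∫⁻ y in ball z (9 * r), ‖ω y‖ₑ ^ 2 * ENNReal.ofReal (annularRamp k a b ‖y - x₀‖) with hAη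
  -- `A9 ≤ (91 k r)⁻¹ Aη ≤ (0.819)⁻¹ Aη`
  have hA9 : ∫⁻ y in ball z (9 * r), ‖ω y‖ₑ ^ 2 ≤ ENNReal.ofReal ((0.819 : ℝ)⁻¹) * Aη := by
    have h1 := ofReal_mul_setLIntegral_le_setLIntegral_mul_annularRamp (M := 9) hk hz
      (fun y => ‖ω y‖ₑ ^ 2)
    rw [show (100 - 9 : ℝ) = 91 by norm_num, ← hr] at h1
    have hc : (0.819 : ℝ) ≤ 91 * k * r := by nlinarith
    calc ∫⁻ y in ball z (9 * r), ‖ω y‖ₑ ^ 2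
        = ENNReal.ofReal ((0.819 : ℝ)⁻¹) * (ENNReal.ofReal 0.819 * ∫⁻ y in ball z (9 * r), ‖ω y‖ₑ ^ 2) := by
          rw [← mul_assoc, ← ENNReal.ofReal_mul (by norm_num), inv_mul_cancel₀ (by norm_num),
            ENNReal.ofReal_one, one_mul]
      _ ≤ ENNReal.ofReal ((0.819 : ℝ)⁻¹) * (ENNReal.ofReal (91 * k * r) *
          ∫⁻ y in ball z (9 * r), ‖ω y‖ₑ ^ 2) :=
          mul_le_mul' le_rfl (mul_le_mul' (ENNReal.ofReal_le_ofReal hc) le_rfl)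
      _ ≤ ENNReal.ofReal ((0.819 : ℝ)⁻¹) * Aη := mul_le_mul' le_rfl h1
  have hm := rms_le hW hk hω hzS
  rw [← hr] at hm
  rw [ofReal_pow_four_mul_rms_pow_three hρ]
  -- `r · A9 · m ≤ r · (0.819⁻¹ Aη) · ((91k)^{-1/2} r⁻² 𝒲ₜ^{1/2})`, and `r · r⁻² = r⁻¹ ≤ k/0.009`
  have hcoef : ENNReal.ofReal r * ENNReal.ofReal ((0.819 : ℝ)⁻¹) *
      ENNReal.ofReal ((91 * k)⁻¹ ^ (1 / 2 : ℝ) * r ^ (-(2 : ℝ))) ≤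
      ENNReal.ofReal ((91 : ℝ)⁻¹ ^ (1 / 2 : ℝ) / (0.819 * 0.009) * k ^ (1 / 2 : ℝ)) := by
    rw [← ENNReal.ofReal_mul hρ.le, ← ENNReal.ofReal_mul (by positivity)]
    refine ENNReal.ofReal_le_ofReal ?_
    have hr2 : r * r ^ (-(2 : ℝ)) = r⁻¹ := by
      rw [show r * r ^ (-(2 : ℝ)) = r ^ (1 : ℝ) * r ^ (-(2 : ℝ)) by rw [Real.rpow_one],
        ← Real.rpow_add hρ]
      norm_num
      exact Real.rpow_neg_one r
    have hk91 : (91 * k)⁻¹ ^ (1 / 2 : ℝ) = (91 : ℝ)⁻¹ ^ (1 / 2 : ℝ) * k⁻¹ ^ (1 / 2 : ℝ) := by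
      rw [mul_inv, Real.mul_rpow (by norm_num) (by positivity)]
    have hrinv : r⁻¹ ≤ k / 0.009 := by
      calc r⁻¹ = k / (k * r) := by field_simp
        _ ≤ k / 0.009 := div_le_div_of_nonneg_left hk.le (by norm_num) hkr
    have hkk : k⁻¹ ^ (1 / 2 : ℝ) * k = k ^ (1 / 2 : ℝ) := by
      rw [Real.inv_rpow hk.le, inv_mul_eq_div,
        show k / k ^ (1 / 2 : ℝ) = k ^ (1 : ℝ) / k ^ (1 / 2 : ℝ) by rw [Real.rpow_one],
        ← Real.rpow_sub hk]
      norm_num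
    calc r * (0.819 : ℝ)⁻¹ * ((91 * k)⁻¹ ^ (1 / 2 : ℝ) * r ^ (-(2 : ℝ)))
        = (0.819 : ℝ)⁻¹ * (91 * k)⁻¹ ^ (1 / 2 : ℝ) * (r * r ^ (-(2 : ℝ))) := by ring
      _ = (0.819 : ℝ)⁻¹ * ((91 : ℝ)⁻¹ ^ (1 / 2 : ℝ) * k⁻¹ ^ (1 / 2 : ℝ)) * r⁻¹ := by rw [hr2, hk91]
      _ ≤ (0.819 : ℝ)⁻¹ * ((91 : ℝ)⁻¹ ^ (1 / 2 : ℝ) * k⁻¹ ^ (1 / 2 : ℝ)) * (k / 0.009) :=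
          mul_le_mul_of_nonneg_left hrinv (by positivity)
      _ = (91 : ℝ)⁻¹ ^ (1 / 2 : ℝ) / (0.819 * 0.009) * (k⁻¹ ^ (1 / 2 : ℝ) * k) := by ring
      _ = _ := by rw [hkk]
  calc ENNReal.ofReal r * (∫⁻ y in ball z (9 * r), ‖ω y‖ₑ ^ 2) * rms ω z r
      ≤ ENNReal.ofReal r * (ENNReal.ofReal ((0.819 : ℝ)⁻¹) * Aη) *
          (ENNReal.ofReal ((91 * k)⁻¹ ^ (1 / 2 : ℝ) * r ^ (-(2 : ℝ))) * 𝒲ₜ ^ (1 / 2 : ℝ)) :=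
        mul_le_mul' (mul_le_mul' le_rfl hA9) hm
    _ = (ENNReal.ofReal r * ENNReal.ofReal ((0.819 : ℝ)⁻¹) *
          ENNReal.ofReal ((91 * k)⁻¹ ^ (1 / 2 : ℝ) * r ^ (-(2 : ℝ)))) * 𝒲ₜ ^ (1 / 2 : ℝ) * Aη := by ring
    _ ≤ _ := mul_le_mul' (mul_le_mul' hcoef le_rfl) le_rfl


/-- **A small ball's chained increment** (Tao: "From (10.23) (once) and (10.24) (twice) one has
`|wⱼ − w_{p(j)}|³ ≲ c^{0.05}δ⁻¹W^{1/2}rⱼ⁻³∫_{10Bⱼ}|∇ω|²`"): for centres `w, p` of the family with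
`ρ(w) ≤ ρ(p) ≤ (10/9)ρ(w)` and `|w − p| ≤ 5ρ(w)`,
`ρ(w)⁴ |m(w) − m(p)|³ ≤ 8C_P'² (91k)^{-1/2} 𝒲ₜ^{1/2} ρ(w) ∫_{B(w,15ρ(w))}‖∇ω‖²`. [cite: Tao2011, §10, proof of Thm. 10.1 (small balls, p. 33)] -/
theorem small_ball_chainStep_le {S : Set ℝ³}
    (hW : IsWhitneyFamily (whitneyRadius x₀ a b k) {x | 0 < annDepth x₀ a b x} S) (hk : 0 < k)
    {ω : ℝ³ → ℝ³} (hω : ContDiff ℝ 1 ω) {w p : ℝ³} (hwS : w ∈ S) (hpS : p ∈ S)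
    (hρwp : whitneyRadius x₀ a b k w ≤ whitneyRadius x₀ a b k p)
    (hρpw : whitneyRadius x₀ a b k p ≤ 10 / 9 * whitneyRadius x₀ a b k w)
    (hdist : dist w p ≤ 5 * whitneyRadius x₀ a b k w) :
    ENNReal.ofReal (whitneyRadius x₀ a b k w ^ 4) *
        ((rms ω w (whitneyRadius x₀ a b k w) - rms ω p (whitneyRadius x₀ a b k p)) +
          (rms ω p (whitneyRadius x₀ a b k p) - rms ω w (whitneyRadius x₀ a b k w))) ^ 3 ≤
      8 * ENNReal.ofReal (2 * (Real.sqrt 32 * 15)) ^ 2 * ENNReal.ofReal ((91 * k)⁻¹ ^ (1 / 2 : ℝ)) *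
        (ENNReal.ofReal (148 ^ 3) * ∫⁻ y, ‖ω y‖ₑ ^ 2 * ENNReal.ofReal (annularRamp k a b ‖y - x₀‖)) ^
          (1 / 2 : ℝ) *
        (ENNReal.ofReal (whitneyRadius x₀ a b k w) *
          ∫⁻ y in ball w (15 * whitneyRadius x₀ a b k w), ‖fderiv ℝ ω y‖ₑ ^ 2) := by
  have hwd : 0 < annDepth x₀ a b w := hW.subset hwS
  have hpd : 0 < annDepth x₀ a b p := hW.subset hpS
  set rw' := whitneyRadius x₀ a b k w with hrw
  set rp := whitneyRadius x₀ a b k p with hrp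
  have hρw : 0 < rw' := whitneyRadius_pos hk hwd
  have hρp : 0 < rp := whitneyRadius_pos hk hpd
  set mw := rms ω w rw' with hmw
  set mp := rms ω p rp with hmp
  set 𝒲ₜ := ENNReal.ofReal (148 ^ 3) * ∫⁻ y, ‖ω y‖ₑ ^ 2 * ENNReal.ofReal (annularRamp k a b ‖y - x₀‖)
    with h𝒲
  set H := ∫⁻ y in ball w (15 * rw'), ‖fderiv ℝ ω y‖ₑ ^ 2 with hH
  set CP := ENNReal.ofReal (2 * (Real.sqrt 32 * 15)) with hCP
  set X := CP * ENNReal.ofReal (rw' ^ (-(1 / 2) : ℝ)) * H ^ (1 / 2 : ℝ) with hX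
  -- (10.24) twice
  obtain ⟨h1, h2⟩ := rms_le_rms_add hω hρw hρwp hρpw hdist
  have hcs1 : (mw - mp) + (mp - mw) ≤ X + X :=
    add_le_add (tsub_le_iff_right.2 (by rw [hX]; exact h1.trans (le_of_eq (by ring))))
      (tsub_le_iff_right.2 (by rw [hX]; exact h2.trans (le_of_eq (by ring))))
  -- (10.23) once
  have hmwle : mw ≤ ENNReal.ofReal ((91 * k)⁻¹ ^ (1 / 2 : ℝ) * rw' ^ (-(2 : ℝ))) * 𝒲ₜ ^ (1 / 2 : ℝ) :=
    rms_le hW hk hω.continuous hwS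
  have hmple : mp ≤ ENNReal.ofReal ((91 * k)⁻¹ ^ (1 / 2 : ℝ) * rp ^ (-(2 : ℝ))) * 𝒲ₜ ^ (1 / 2 : ℝ) :=
    rms_le hW hk hω.continuous hpS
  set Y := ENNReal.ofReal ((91 * k)⁻¹ ^ (1 / 2 : ℝ) * rw' ^ (-(2 : ℝ))) * 𝒲ₜ ^ (1 / 2 : ℝ) with hY
  have hpw2 : ENNReal.ofReal ((91 * k)⁻¹ ^ (1 / 2 : ℝ) * rp ^ (-(2 : ℝ))) ≤
      ENNReal.ofReal ((91 * k)⁻¹ ^ (1 / 2 : ℝ) * rw' ^ (-(2 : ℝ))) := by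
    refine ENNReal.ofReal_le_ofReal (mul_le_mul_of_nonneg_left ?_ (by positivity))
    rw [Real.rpow_neg hρp.le, Real.rpow_neg hρw.le]
    exact inv_anti₀ (by positivity) (Real.rpow_le_rpow hρw.le hρwp (by norm_num))
  have hcs2 : (mw - mp) + (mp - mw) ≤ Y + Y :=
    add_le_add (tsub_le_self.trans hmwle) (tsub_le_self.trans (hmple.trans (mul_le_mul' hpw2 le_rfl)))
  -- cube
  have hcube : ((mw - mp) + (mp - mw)) ^ 3 ≤ (Y + Y) * (X + X) ^ 2 := by
    rw [pow_succ', sq, sq]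
    exact mul_le_mul' hcs2 (mul_le_mul' hcs1 hcs1)
  -- algebra: `(X+X)² = 4 CP² ρ⁻¹ H`, `Y + Y = 2 (91k)^{-1/2} ρ⁻² 𝒲ₜ^{1/2}`, `ρ⁴ ρ⁻² ρ⁻¹ = ρ`
  have rpow_half_sq : ∀ A : ℝ≥0∞, (A ^ (1 / 2 : ℝ)) ^ 2 = A := fun A => by
    simpa [one_div] using ENNReal.rpow_inv_natCast_pow two_ne_zero A
  have hX2 : (X + X) ^ 2 = 4 * CP ^ 2 * ENNReal.ofReal (rw' ^ (-(1 : ℝ))) * H := by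
    rw [← two_mul, mul_pow, hX, mul_pow, mul_pow, rpow_half_sq,
      ← ENNReal.ofReal_pow (Real.rpow_nonneg hρw.le _), ← Real.rpow_natCast,
      ← Real.rpow_mul hρw.le]
    norm_num
    ring
  have hrr : ENNReal.ofReal (rw' ^ 4) * ENNReal.ofReal ((91 * k)⁻¹ ^ (1 / 2 : ℝ) * rw' ^ (-(2 : ℝ))) *
      ENNReal.ofReal (rw' ^ (-(1 : ℝ))) =
      ENNReal.ofReal ((91 * k)⁻¹ ^ (1 / 2 : ℝ)) * ENNReal.ofReal rw' := by
    rw [← ENNReal.ofReal_mul (by positivity), ← ENNReal.ofReal_mul (by positivity),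
      ← ENNReal.ofReal_mul (by positivity)]
    congr 1
    have : rw' ^ 4 * rw' ^ (-(2 : ℝ)) * rw' ^ (-(1 : ℝ)) = rw' := by
      rw [show rw' ^ 4 = rw' ^ (4 : ℝ) by norm_cast, ← Real.rpow_add hρw, ← Real.rpow_add hρw]
      norm_num
    calc rw' ^ 4 * ((91 * k)⁻¹ ^ (1 / 2 : ℝ) * rw' ^ (-(2 : ℝ))) * rw' ^ (-(1 : ℝ))
        = (91 * k)⁻¹ ^ (1 / 2 : ℝ) * (rw' ^ 4 * rw' ^ (-(2 : ℝ)) * rw' ^ (-(1 : ℝ))) := by ring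
      _ = _ := by rw [this]
  calc ENNReal.ofReal (rw' ^ 4) * ((mw - mp) + (mp - mw)) ^ 3
      ≤ ENNReal.ofReal (rw' ^ 4) * ((Y + Y) * (X + X) ^ 2) := mul_le_mul' le_rfl hcube
    _ = ENNReal.ofReal (rw' ^ 4) * ((2 * Y) * (4 * CP ^ 2 * ENNReal.ofReal (rw' ^ (-(1 : ℝ))) * H)) := by
        rw [hX2, two_mul]
    _ = 8 * CP ^ 2 * (ENNReal.ofReal (rw' ^ 4) *
          ENNReal.ofReal ((91 * k)⁻¹ ^ (1 / 2 : ℝ) * rw' ^ (-(2 : ℝ))) *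
          ENNReal.ofReal (rw' ^ (-(1 : ℝ)))) * 𝒲ₜ ^ (1 / 2 : ℝ) * H := by
        rw [hY]; ring
    _ = 8 * CP ^ 2 * ENNReal.ofReal ((91 * k)⁻¹ ^ (1 / 2 : ℝ)) * 𝒲ₜ ^ (1 / 2 : ℝ) *
          (ENNReal.ofReal rw' * H) := by
        rw [hrr]; ring


/-- `ρ(x) ∫_{B(x,15ρ)} ‖∇ω‖² ≤ (85k)⁻¹ ∫_{B(x,15ρ)} ‖∇ω‖² η` on a ball of the family. [cite: Tao2011, §10, proof of Thm. 10.1 ((10.20))] -/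
theorem ofReal_mul_setLIntegral_fifteen_le {x : ℝ³} (hk : 0 < k) (hx : 0 < annDepth x₀ a b x)
    (f : ℝ³ → ℝ≥0∞) :
    ENNReal.ofReal (whitneyRadius x₀ a b k x) * ∫⁻ y in ball x (15 * whitneyRadius x₀ a b k x), f y ≤
      ENNReal.ofReal ((85 * k)⁻¹) * ∫⁻ y in ball x (15 * whitneyRadius x₀ a b k x),
        f y * ENNReal.ofReal (annularRamp k a b ‖y - x₀‖) := by
  have h := ofReal_mul_setLIntegral_le_setLIntegral_mul_annularRamp (M := 15) hk hx f
  rw [show (100 - 15 : ℝ) = 85 by norm_num] at h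
  have hρ : 0 < whitneyRadius x₀ a b k x := whitneyRadius_pos hk hx
  have hc : (0 : ℝ) < 85 * k := by positivity
  calc ENNReal.ofReal (whitneyRadius x₀ a b k x) * ∫⁻ y in ball x (15 * whitneyRadius x₀ a b k x), f y
      = ENNReal.ofReal ((85 * k)⁻¹) * (ENNReal.ofReal (85 * k * whitneyRadius x₀ a b k x) *
          ∫⁻ y in ball x (15 * whitneyRadius x₀ a b k x), f y) := by
        rw [← mul_assoc, ← ENNReal.ofReal_mul (by positivity), show (85 * k)⁻¹ * (85 * k *
          whitneyRadius x₀ a b k x) = ((85 * k)⁻¹ * (85 * k)) * whitneyRadius x₀ a b k x by ring,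
          inv_mul_cancel₀ hc.ne', one_mul]
    _ ≤ _ := mul_le_mul' le_rfl h

/-- **The lower-order term `Σᵢ rᵢ⁴wᵢ³` over the whole family** (Tao, p. 33): with
`𝒲ₜ = 148³∫|ω|²η`,
`Σₓ ρ(x)⁴ m(x)³ ≤ (1 + 8C₀) c_b k^{1/2} 𝒲ₜ^{1/2} · 148³ ∫|ω|²η + 8C₁ c_s (91k)^{-1/2}𝒲ₜ^{1/2}(85k)⁻¹ · 244³ ∫‖∇ω‖²η`
— big balls directly, small balls through the parent chains (`TaoWhitneyChaining`). [cite: Tao2011, §10, proof of Thm. 10.1 (the term Σ rᵢ⁴wᵢ³, p. 33)] -/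
theorem tsum_pow_four_rms_le (ha : 0 < a) (hk : 0 < k) (hab : a + 2 * k⁻¹ < b) {S : Set ℝ³}
    (hW : IsWhitneyFamily (whitneyRadius x₀ a b k) {x | 0 < annDepth x₀ a b x} S)
    {ω : ℝ³ → ℝ³} (hω : ContDiff ℝ 1 ω) :
    ∃ C₀ C₁ : ℝ≥0∞, C₀ ≠ ⊤ ∧ C₁ ≠ ⊤ ∧
      (C₀ = ENNReal.ofReal ((4 * (5 / (2 / 101 : ℝ)) + 5) ^ 3) * ∑' j : ℕ,
          ENNReal.ofReal ((1 + (2 / 101 : ℝ))⁻¹) ^ j) ∧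
      (C₁ = ENNReal.ofReal ((4 * (5 / (2 / 101 : ℝ)) + 5) ^ 3) * ∑' i : ℕ,
          ((i : ℝ≥0∞) + 2) ^ 4 * ENNReal.ofReal ((1 + (2 / 101 : ℝ))⁻¹) ^ i) ∧
      ∑' x : S, ENNReal.ofReal (whitneyRadius x₀ a b k x ^ 4) * rms ω x (whitneyRadius x₀ a b k x) ^ 3 ≤
        (1 + 8 * C₀) * (ENNReal.ofReal ((91 : ℝ)⁻¹ ^ (1 / 2 : ℝ) / (0.819 * 0.009) * k ^ (1 / 2 : ℝ)) *
          (ENNReal.ofReal (148 ^ 3) * ∫⁻ y, ‖ω y‖ₑ ^ 2 * ENNReal.ofReal (annularRamp k a b ‖y - x₀‖)) ^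
            (1 / 2 : ℝ) *
          (ENNReal.ofReal (148 ^ 3) * ∫⁻ y, ‖ω y‖ₑ ^ 2 * ENNReal.ofReal (annularRamp k a b ‖y - x₀‖))) +
        8 * C₁ * (8 * ENNReal.ofReal (2 * (Real.sqrt 32 * 15)) ^ 2 *
          ENNReal.ofReal ((91 * k)⁻¹ ^ (1 / 2 : ℝ)) *
          (ENNReal.ofReal (148 ^ 3) * ∫⁻ y, ‖ω y‖ₑ ^ 2 * ENNReal.ofReal (annularRamp k a b ‖y - x₀‖)) ^
            (1 / 2 : ℝ) *
          (ENNReal.ofReal ((85 * k)⁻¹) * (ENNReal.ofReal (244 ^ 3) *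
            ∫⁻ y, ‖fderiv ℝ ω y‖ₑ ^ 2 * ENNReal.ofReal (annularRamp k a b ‖y - x₀‖)))) := by
  classical
  set ρ := whitneyRadius x₀ a b k with hρdef
  set θ : ℝ := 2 / 101 with hθ
  have hθ0 : 0 < θ := by norm_num
  set ϑ : ℝ≥0∞ := ENNReal.ofReal ((1 + θ)⁻¹) with hϑ
  have hϑ1 : ϑ < 1 := by
    rw [hϑ, ← ENNReal.ofReal_one]
    exact (ENNReal.ofReal_lt_ofReal_iff one_pos).2 (inv_lt_one_of_one_lt₀ (by norm_num))
  set Cg : ℝ≥0∞ := ENNReal.ofReal ((4 * (5 / θ) + 5) ^ 3) with hCg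
  set C₀ : ℝ≥0∞ := Cg * ∑' j : ℕ, ϑ ^ j with hC₀
  set C₁ : ℝ≥0∞ := Cg * ∑' i : ℕ, ((i : ℝ≥0∞) + 2) ^ 4 * ϑ ^ i with hC₁
  have hC₀top : C₀ ≠ ⊤ := ENNReal.mul_ne_top ENNReal.ofReal_ne_top
    (WhitneyChain.tsum_geometric_lt_top hϑ1).ne
  have hC₁top : C₁ ≠ ⊤ := ENNReal.mul_ne_top ENNReal.ofReal_ne_top
    (WhitneyChain.tsum_pow_four_mul_geometric_lt_top hϑ1).ne
  refine ⟨C₀, C₁, hC₀top, hC₁top, rfl, rfl, ?_⟩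
  -- the parent map on the subtype
  set big : Set S := {x | 0.9 * k⁻¹ ≤ annDepth x₀ a b (x : ℝ³)} with hbig
  have hpar : ∀ x : S, ∃ p : S, (x ∉ big → (103 / 101 * ρ x ≤ ρ p ∧ ρ p ≤ 104 / 99 * ρ x ∧
      dist (x : ℝ³) p ≤ 5 * ρ x)) := by
    intro x
    by_cases hx : x ∈ big
    · exact ⟨x, fun h => absurd hx h⟩
    · have hsmall : annDepth x₀ a b (x : ℝ³) < 0.9 * k⁻¹ := not_le.1 hx
      obtain ⟨p, hpS, h1, h2, h3⟩ := exists_parent ha hk hab hW x.2 hsmall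
      exact ⟨⟨p, hpS⟩, fun _ => ⟨h1, h2, h3⟩⟩
  choose P hP using hpar
  have hposS : ∀ x : S, 0 < ρ x := fun x => whitneyRadius_pos hk (hW.subset x.2)
  have hgrow : ∀ x : S, x ∉ big → (1 + θ) * ρ x ≤ ρ (P x) := fun x hx => by
    have := (hP x hx).1
    rw [hθ]; linarith
  have hdistP : ∀ x : S, x ∉ big → dist (x : ℝ³) (P x) ≤ 5 * ρ x := fun x hx => (hP x hx).2.2
  have hterm : ∀ x : S, ∃ n, P^[n] x ∈ big :=
    WhitneyChain.exists_iterate_mem P big (ρ := fun x : S => ρ x) (R := k⁻¹ / 100) hθ0 hposS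
      (fun x => whitneyRadius_le_inv_div hk _) hgrow
  set gen := WhitneyChain.gen' P big hterm with hgen
  have hgen0 : ∀ x, P^[gen x] x ∈ big := WhitneyChain.iterate_gen'_mem P big hterm
  have hgen1 : ∀ x i, i < gen x → P^[i] x ∉ big := WhitneyChain.iterate_notMem_of_lt_gen' P big hterm
  -- per-generation packing and the two effective packing bounds
  set M : S → ℝ≥0∞ := fun x => ENNReal.ofReal (ρ x ^ 4) with hM
  have hpack : ∀ (z : S) (j : ℕ), ∑' x : S, (if P^[j] x = z ∧ j ≤ gen x then M x else 0) ≤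
      Cg * ϑ ^ j * M z := fun z j =>
    tsum_pow_four_chain_le (E := ℝ³) finrank_euclideanSpace_fin hW.countable hW.disjoint
      (fun x hx => whitneyRadius_pos hk (hW.subset hx)) P big gen hgen1 hθ0 (by norm_num) hgrow
      hdistP z j
  have hpack0 := fun z => WhitneyChain.pack_ancestor (p := P) (big := big) (gen := gen) hpack z
  have hpack1 := fun w => WhitneyChain.pack_descendant (p := P) (gen := gen) hpack w
  set m : S → ℝ≥0∞ := fun x => rms ω x (ρ x) with hm
  have hchain := WhitneyChain.tsum_small_le_of_chain (p := P) (big := big) (gen := gen) hgen0 hgen1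
    hpack0 hpack1 m
  -- abbreviations for the global quantities
  set 𝒲ₜ := ENNReal.ofReal (148 ^ 3) * ∫⁻ y, ‖ω y‖ₑ ^ 2 * ENNReal.ofReal (annularRamp k a b ‖y - x₀‖)
    with h𝒲
  set Kb := ENNReal.ofReal ((91 : ℝ)⁻¹ ^ (1 / 2 : ℝ) / (0.819 * 0.009) * k ^ (1 / 2 : ℝ)) with hKb
  set Ks := 8 * ENNReal.ofReal (2 * (Real.sqrt 32 * 15)) ^ 2 * ENNReal.ofReal ((91 * k)⁻¹ ^ (1 / 2 : ℝ))
    with hKs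
  -- big balls
  have hbigsum : ∑' z : S, (if z ∈ big then M z * m z ^ 3 else 0) ≤ Kb * 𝒲ₜ ^ (1 / 2 : ℝ) * 𝒲ₜ := by
    have hmeas : AEMeasurable (fun y => ‖ω y‖ₑ ^ 2 * ENNReal.ofReal (annularRamp k a b ‖y - x₀‖)) volume :=
      (hω.continuous.aemeasurable.enorm.pow_const 2).mul (ENNReal.measurable_ofReal.comp_aemeasurable
        (((continuous_annularRamp hk.le a b).comp (continuous_id.sub continuous_const).norm).aemeasurable))
    have hov := tsum_setLIntegral_whitneyBall_le hW hk (by norm_num : (0:ℝ) ≤ 9) (by norm_num) hmeas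
    calc ∑' z : S, (if z ∈ big then M z * m z ^ 3 else 0)
        ≤ ∑' z : S, Kb * 𝒲ₜ ^ (1 / 2 : ℝ) * ∫⁻ y in ball (z : ℝ³) (9 * ρ z), ‖ω y‖ₑ ^ 2 *
            ENNReal.ofReal (annularRamp k a b ‖y - x₀‖) := by
          refine ENNReal.tsum_le_tsum fun z => ?_
          by_cases hz : z ∈ big
          · rw [if_pos hz]
            exact big_ball_rms_le hW hk hω.continuous z.2 hz
          · rw [if_neg hz]; exact bot_le
      _ = Kb * 𝒲ₜ ^ (1 / 2 : ℝ) * ∑' z : S, ∫⁻ y in ball (z : ℝ³) (9 * ρ z), ‖ω y‖ₑ ^ 2 *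
            ENNReal.ofReal (annularRamp k a b ‖y - x₀‖) := ENNReal.tsum_mul_left
      _ ≤ Kb * 𝒲ₜ ^ (1 / 2 : ℝ) * 𝒲ₜ := by
          refine mul_le_mul' le_rfl (hov.trans (le_of_eq ?_))
          rw [h𝒲]; norm_num
  -- small balls: the chained increments
  have hsmallsum : ∑' w : S, (if w ∈ big then 0 else M w * WhitneyChain.chainStep P m w ^ 3) ≤
      Ks * 𝒲ₜ ^ (1 / 2 : ℝ) * (ENNReal.ofReal ((85 * k)⁻¹) * (ENNReal.ofReal (244 ^ 3) *
        ∫⁻ y, ‖fderiv ℝ ω y‖ₑ ^ 2 * ENNReal.ofReal (annularRamp k a b ‖y - x₀‖))) := by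
    have hmeas : AEMeasurable (fun y => ‖fderiv ℝ ω y‖ₑ ^ 2 *
        ENNReal.ofReal (annularRamp k a b ‖y - x₀‖)) volume :=
      ((hω.continuous_fderiv one_ne_zero).aemeasurable.enorm.pow_const 2).mul
        (ENNReal.measurable_ofReal.comp_aemeasurable
        (((continuous_annularRamp hk.le a b).comp (continuous_id.sub continuous_const).norm).aemeasurable))
    have hov := tsum_setLIntegral_whitneyBall_le hW hk (by norm_num : (0:ℝ) ≤ 15) (by norm_num) hmeas
    calc ∑' w : S, (if w ∈ big then 0 else M w * WhitneyChain.chainStep P m w ^ 3)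
        ≤ ∑' w : S, Ks * 𝒲ₜ ^ (1 / 2 : ℝ) * (ENNReal.ofReal ((85 * k)⁻¹) *
            ∫⁻ y in ball (w : ℝ³) (15 * ρ w), ‖fderiv ℝ ω y‖ₑ ^ 2 *
              ENNReal.ofReal (annularRamp k a b ‖y - x₀‖)) := by
          refine ENNReal.tsum_le_tsum fun w => ?_
          by_cases hw : w ∈ big
          · rw [if_pos hw]; exact bot_le
          · rw [if_neg hw]
            obtain ⟨h1, h2, h3⟩ := hP w hw
            have hle1 : ρ w ≤ ρ (P w) := by linarith [hposS w]
            have hle2 : ρ (P w) ≤ 10 / 9 * ρ w := by linarith [hposS w]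
            have hs := small_ball_chainStep_le hW hk hω w.2 (P w).2 hle1 hle2 h3
            rw [WhitneyChain.chainStep_def]
            refine hs.trans ?_
            rw [← hKs]
            exact mul_le_mul' le_rfl (ofReal_mul_setLIntegral_fifteen_le hk (hW.subset w.2) _)
      _ = Ks * 𝒲ₜ ^ (1 / 2 : ℝ) * (ENNReal.ofReal ((85 * k)⁻¹) *
            ∑' w : S, ∫⁻ y in ball (w : ℝ³) (15 * ρ w), ‖fderiv ℝ ω y‖ₑ ^ 2 *
              ENNReal.ofReal (annularRamp k a b ‖y - x₀‖)) := by
          rw [ENNReal.tsum_mul_left, ENNReal.tsum_mul_left]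
      _ ≤ _ := by
          refine mul_le_mul' le_rfl (mul_le_mul' le_rfl (hov.trans (le_of_eq ?_)))
          norm_num
  -- split the sum and chain
  have hsplit : ∑' x : S, M x * m x ^ 3 =
      ∑' x : S, (if x ∈ big then M x * m x ^ 3 else 0) +
        ∑' x : S, (if x ∈ big then 0 else M x * m x ^ 3) := by
    rw [← ENNReal.tsum_add]
    refine tsum_congr fun x => ?_
    split_ifs <;> simp
  rw [hsplit]
  calc ∑' x : S, (if x ∈ big then M x * m x ^ 3 else 0) +
        ∑' x : S, (if x ∈ big then 0 else M x * m x ^ 3)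
      ≤ ∑' x : S, (if x ∈ big then M x * m x ^ 3 else 0) +
          (8 * C₀ * ∑' z : S, (if z ∈ big then M z * m z ^ 3 else 0) +
            8 * C₁ * ∑' w : S, (if w ∈ big then 0 else M w * WhitneyChain.chainStep P m w ^ 3)) :=
        add_le_add le_rfl hchain
    _ = (1 + 8 * C₀) * ∑' z : S, (if z ∈ big then M z * m z ^ 3 else 0) +
          8 * C₁ * ∑' w : S, (if w ∈ big then 0 else M w * WhitneyChain.chainStep P m w ^ 3) := by ring
    _ ≤ (1 + 8 * C₀) * (Kb * 𝒲ₜ ^ (1 / 2 : ℝ) * 𝒲ₜ) +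
          8 * C₁ * (Ks * 𝒲ₜ ^ (1 / 2 : ℝ) * (ENNReal.ofReal ((85 * k)⁻¹) * (ENNReal.ofReal (244 ^ 3) *
            ∫⁻ y, ‖fderiv ℝ ω y‖ₑ ^ 2 * ENNReal.ofReal (annularRamp k a b ‖y - x₀‖)))) :=
        add_le_add (mul_le_mul' le_rfl hbigsum) (mul_le_mul' le_rfl hsmallsum)


/-- **The main part of `Y₆,₁` on one ball**: `k ρ^{3/2} ∫_{B(x,3ρ)}‖∇ω‖² · (∫_{B(x,9ρ)}|ω|²)^{1/2}
≤ 91^{-1/2}97⁻¹ k^{-1/2} 𝒲ₜ^{1/2} ∫_{B(x,3ρ)}‖∇ω‖²η` (Tao: "`c^{-0.1}δ² Σᵢ rᵢ³wᵢ‖∇ω‖²_{L²(3Bᵢ)} ≲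
c^{0.05}δ⁻¹W^{1/2}Y₁`"). [cite: Tao2011, §10, proof of Thm. 10.1 (first term of (10.21), p. 32)] -/
theorem term1a_le {S : Set ℝ³}
    (hW : IsWhitneyFamily (whitneyRadius x₀ a b k) {x | 0 < annDepth x₀ a b x} S) (hk : 0 < k)
    {ω : ℝ³ → ℝ³} (hω : Continuous ω) {x : ℝ³} (hxS : x ∈ S) (G : ℝ³ → ℝ≥0∞) :
    ENNReal.ofReal (k * whitneyRadius x₀ a b k x ^ (3 / 2 : ℝ)) *
        (∫⁻ y in ball x (3 * whitneyRadius x₀ a b k x), G y) *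
          (∫⁻ y in ball x (9 * whitneyRadius x₀ a b k x), ‖ω y‖ₑ ^ 2) ^ (1 / 2 : ℝ) ≤
      ENNReal.ofReal ((91 : ℝ)⁻¹ ^ (1 / 2 : ℝ) * 97⁻¹ * k ^ (-(1 / 2) : ℝ)) *
        (ENNReal.ofReal (148 ^ 3) * ∫⁻ y, ‖ω y‖ₑ ^ 2 * ENNReal.ofReal (annularRamp k a b ‖y - x₀‖)) ^
          (1 / 2 : ℝ) *
        ∫⁻ y in ball x (3 * whitneyRadius x₀ a b k x), G y * ENNReal.ofReal (annularRamp k a b ‖y - x₀‖) := by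
  have hx : 0 < annDepth x₀ a b x := hW.subset hxS
  set r := whitneyRadius x₀ a b k x with hr
  have hρ : 0 < r := whitneyRadius_pos hk hx
  set 𝒲ₜ := ENNReal.ofReal (148 ^ 3) * ∫⁻ y, ‖ω y‖ₑ ^ 2 * ENNReal.ofReal (annularRamp k a b ‖y - x₀‖)
  have hA := setLIntegral_nineBall_le hW hk hω hxS
  rw [← hr] at hA
  have hA2 : (∫⁻ y in ball x (9 * r), ‖ω y‖ₑ ^ 2) ^ (1 / 2 : ℝ) ≤
      ENNReal.ofReal (((91 * k * r)⁻¹) ^ (1 / 2 : ℝ)) * 𝒲ₜ ^ (1 / 2 : ℝ) := by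
    calc (∫⁻ y in ball x (9 * r), ‖ω y‖ₑ ^ 2) ^ (1 / 2 : ℝ)
        ≤ (ENNReal.ofReal ((91 * k * r)⁻¹) * 𝒲ₜ) ^ (1 / 2 : ℝ) := ENNReal.rpow_le_rpow hA (by norm_num)
      _ = _ := by rw [ENNReal.mul_rpow_of_nonneg _ _ (by norm_num), ENNReal.ofReal_rpow_of_nonneg
          (by positivity) (by norm_num)]
  have hG := ofReal_mul_setLIntegral_le_setLIntegral_mul_annularRamp (M := 3) hk hx G
  rw [show (100 - 3 : ℝ) = 97 by norm_num, ← hr] at hG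
  -- coefficient algebra: `k r^{3/2} (91kr)^{-1/2} = 91^{-1/2} 97⁻¹ k^{-1/2} · (97 k r)`
  have hcoef : ENNReal.ofReal (k * r ^ (3 / 2 : ℝ)) * ENNReal.ofReal (((91 * k * r)⁻¹) ^ (1 / 2 : ℝ)) =
      ENNReal.ofReal ((91 : ℝ)⁻¹ ^ (1 / 2 : ℝ) * 97⁻¹ * k ^ (-(1 / 2) : ℝ)) * ENNReal.ofReal (97 * k * r) := by
    rw [← ENNReal.ofReal_mul (by positivity), ← ENNReal.ofReal_mul (by positivity)]
    congr 1
    rw [mul_inv, mul_inv, Real.mul_rpow (by positivity) (by positivity),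
      Real.mul_rpow (by positivity) (by positivity), Real.inv_rpow hk.le, Real.inv_rpow hρ.le,
      ← Real.rpow_neg hk.le, ← Real.rpow_neg hρ.le]
    have e1 : r ^ (3 / 2 : ℝ) * r ^ (-(1 / 2) : ℝ) = r := by
      rw [← Real.rpow_add hρ]; norm_num
    have e2 : k * k ^ (-(1 / 2) : ℝ) = k ^ (-(1 / 2) : ℝ) * k := mul_comm _ _
    calc k * r ^ (3 / 2 : ℝ) * ((91 : ℝ)⁻¹ ^ (1 / 2 : ℝ) * k ^ (-(1 / 2) : ℝ) * r ^ (-(1 / 2) : ℝ))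
        = (91 : ℝ)⁻¹ ^ (1 / 2 : ℝ) * (k * k ^ (-(1 / 2) : ℝ)) * (r ^ (3 / 2 : ℝ) * r ^ (-(1 / 2) : ℝ)) := by
          ring
      _ = (91 : ℝ)⁻¹ ^ (1 / 2 : ℝ) * 97⁻¹ * k ^ (-(1 / 2) : ℝ) * (97 * k * r) := by
          rw [e1, e2]; field_simp
  calc ENNReal.ofReal (k * r ^ (3 / 2 : ℝ)) * (∫⁻ y in ball x (3 * r), G y) *
        (∫⁻ y in ball x (9 * r), ‖ω y‖ₑ ^ 2) ^ (1 / 2 : ℝ)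
      ≤ ENNReal.ofReal (k * r ^ (3 / 2 : ℝ)) * (∫⁻ y in ball x (3 * r), G y) *
          (ENNReal.ofReal (((91 * k * r)⁻¹) ^ (1 / 2 : ℝ)) * 𝒲ₜ ^ (1 / 2 : ℝ)) :=
        mul_le_mul' le_rfl hA2
    _ = (ENNReal.ofReal (k * r ^ (3 / 2 : ℝ)) * ENNReal.ofReal (((91 * k * r)⁻¹) ^ (1 / 2 : ℝ))) *
          𝒲ₜ ^ (1 / 2 : ℝ) * (∫⁻ y in ball x (3 * r), G y) := by ring
    _ = ENNReal.ofReal ((91 : ℝ)⁻¹ ^ (1 / 2 : ℝ) * 97⁻¹ * k ^ (-(1 / 2) : ℝ)) * 𝒲ₜ ^ (1 / 2 : ℝ) *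
          (ENNReal.ofReal (97 * k * r) * ∫⁻ y in ball x (3 * r), G y) := by rw [hcoef]; ring
    _ ≤ _ := mul_le_mul' le_rfl hG

/-- **`Y₆,₂` on a small ball**: for `d(x) < 0.9k⁻¹` and `|u| ≤ s`,
`kρ · Cρ⁻⁴ · (∫_{B(x,4ρ)}|u|) · ∫_{B(x,ρ)}|ω|² ≤ 64 C |B₁| · k s · ∫_{B(x,ρ)} |ω|² 1_{layer}` (Tao: "we use
Hölder to bound `r^{-3/2}‖u‖_{L²(2Bᵢ)} ≲ ‖u‖_{L^∞}` … the contribution of this term to `Y₆,₂` is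
`O(c^{0.9}Y₂)`"). [cite: Tao2011, §10, proof of Thm. 10.1 (Y₆,₂, balls in the layer, p. 32)] -/
theorem term2_small_le (hk : 0 < k) (hab : a + 2 * k⁻¹ < b) {u : ℝ³ → ℝ³} {s : ℝ} (hs0 : 0 ≤ s)
    (hs : ∀ y, ‖u y‖ ≤ s) {x : ℝ³} (hx : 0 < annDepth x₀ a b x) (hsmall : annDepth x₀ a b x < 0.9 * k⁻¹)
    {C : ℝ} (hC : 0 ≤ C) (f : ℝ³ → ℝ≥0∞) :
    ENNReal.ofReal (k * whitneyRadius x₀ a b k x) *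
        (ENNReal.ofReal (C * (whitneyRadius x₀ a b k x)⁻¹ ^ 4) *
          (∫⁻ w in ball x (4 * whitneyRadius x₀ a b k x), ‖u w‖ₑ) *
            ∫⁻ y in ball x (whitneyRadius x₀ a b k x), f y) ≤
      ENNReal.ofReal (64 * C * k * s) * volume (ball (0 : ℝ³) 1) *
        ∫⁻ y in ball x (whitneyRadius x₀ a b k x), f y *
          {y : ℝ³ | (a < ‖y - x₀‖ ∧ ‖y - x₀‖ < a + k⁻¹) ∨ (b - k⁻¹ < ‖y - x₀‖ ∧ ‖y - x₀‖ < b)}.indicator 1 y := by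
  set r := whitneyRadius x₀ a b k x with hr
  have hρ : 0 < r := whitneyRadius_pos hk hx
  -- `∫_{B(x,4r)} |u| ≤ s |B(x,4r)| = s (4r)³ |B₁|`
  have hL : ∫⁻ w in ball x (4 * r), ‖u w‖ₑ ≤ ENNReal.ofReal (s * (4 * r) ^ 3) * volume (ball (0 : ℝ³) 1) := by
    calc ∫⁻ w in ball x (4 * r), ‖u w‖ₑ ≤ ∫⁻ _ in ball x (4 * r), ENNReal.ofReal s :=
          lintegral_mono fun w => by rw [← ofReal_norm]; exact ENNReal.ofReal_le_ofReal (hs w)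
      _ = ENNReal.ofReal s * volume (ball x (4 * r)) := setLIntegral_const _ _
      _ = _ := by
          rw [Measure.addHaar_ball volume x (by positivity : (0 : ℝ) ≤ 4 * r), finrank_euclideanSpace_fin,
            ← mul_assoc, ← ENNReal.ofReal_mul hs0]
  -- the ball lies in the layer: `∫_B f = ∫_B f 1_layer`
  have hlayer : ∫⁻ y in ball x r, f y = ∫⁻ y in ball x r, f y *
      {y : ℝ³ | (a < ‖y - x₀‖ ∧ ‖y - x₀‖ < a + k⁻¹) ∨ (b - k⁻¹ < ‖y - x₀‖ ∧ ‖y - x₀‖ < b)}.indicator 1 y := by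
    refine setLIntegral_congr_fun measurableSet_ball fun y hy => ?_
    have hyl := ball_subset_layer hk hx hsmall hy
    rw [setOf_annDepth_lt_eq hk hab] at hyl
    rw [indicator_of_mem hyl, Pi.one_apply, mul_one]
  rw [← hlayer]
  -- coefficient: `k r · C r⁻⁴ · s (4r)³ = 64 C k s`
  have hcoef : ENNReal.ofReal (k * r) * ENNReal.ofReal (C * r⁻¹ ^ 4) * ENNReal.ofReal (s * (4 * r) ^ 3) =
      ENNReal.ofReal (64 * C * k * s) := by
    rw [← ENNReal.ofReal_mul (by positivity), ← ENNReal.ofReal_mul (by positivity)]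
    congr 1
    field_simp
    ring
  calc ENNReal.ofReal (k * r) * (ENNReal.ofReal (C * r⁻¹ ^ 4) * (∫⁻ w in ball x (4 * r), ‖u w‖ₑ) *
        ∫⁻ y in ball x r, f y)
      ≤ ENNReal.ofReal (k * r) * (ENNReal.ofReal (C * r⁻¹ ^ 4) *
          (ENNReal.ofReal (s * (4 * r) ^ 3) * volume (ball (0 : ℝ³) 1)) * ∫⁻ y in ball x r, f y) :=
        mul_le_mul' le_rfl (mul_le_mul' (mul_le_mul' le_rfl hL) le_rfl)
    _ = (ENNReal.ofReal (k * r) * ENNReal.ofReal (C * r⁻¹ ^ 4) * ENNReal.ofReal (s * (4 * r) ^ 3)) *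
          volume (ball (0 : ℝ³) 1) * ∫⁻ y in ball x r, f y := by ring
    _ = _ := by rw [hcoef]

/-- **`Y₆,₂` on a big ball**: for `0.9k⁻¹ ≤ d(x)`,
`kρ · Cρ⁻⁴ · (∫_{B(x,4ρ)}|u|) · ∫_{B(x,ρ)}|ω|² ≤ 8C|B₁|^{1/2} (0.009)^{-3/2} 0.891⁻¹ k^{5/2} ‖u‖_{L²} ∫_{B(x,ρ)}|ω|²η`
(Tao: "we use Lemma 8.1 to bound `rᵢ^{-3/2}‖u‖_{L²(2Bᵢ)} ≲ c^{-0.15}δ³E₀^{1/2}` … the contribution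
of this case is `O(c^{-0.25}δ⁵E₀^{1/2}W)`"). [cite: Tao2011, §10, proof of Thm. 10.1 (Y₆,₂, large balls, p. 32)] -/
theorem term2_big_le (hk : 0 < k) {u : ℝ³ → ℝ³} (hu : Continuous u) {x : ℝ³}
    (hbig : 0.9 * k⁻¹ ≤ annDepth x₀ a b x) {C : ℝ} (hC : 0 ≤ C) :
    ENNReal.ofReal (k * whitneyRadius x₀ a b k x) *
        (ENNReal.ofReal (C * (whitneyRadius x₀ a b k x)⁻¹ ^ 4) *
          (∫⁻ w in ball x (4 * whitneyRadius x₀ a b k x), ‖u w‖ₑ) *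
            ∫⁻ y in ball x (whitneyRadius x₀ a b k x), ‖curl u y‖ₑ ^ 2) ≤
      ENNReal.ofReal (8 * C * (0.009 : ℝ) ^ (-(3 / 2) : ℝ) * (0.891 : ℝ)⁻¹ * k ^ (5 / 2 : ℝ)) *
        (volume (ball (0 : ℝ³) 1)) ^ (1 / 2 : ℝ) * (∫⁻ w, ‖u w‖ₑ ^ 2) ^ (1 / 2 : ℝ) *
        ∫⁻ y in ball x (whitneyRadius x₀ a b k x), ‖curl u y‖ₑ ^ 2 *
          ENNReal.ofReal (annularRamp k a b ‖y - x₀‖) := by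
  have hki : 0 < k⁻¹ := inv_pos.2 hk
  have hx : 0 < annDepth x₀ a b x := by nlinarith
  set r := whitneyRadius x₀ a b k x with hr
  have hρ : 0 < r := whitneyRadius_pos hk hx
  have hrk : 0.9 * k⁻¹ / 100 ≤ r := le_whitneyRadius_of_le hk hbig
  have hkr : 0.009 ≤ k * r := by
    have := mul_le_mul_of_nonneg_left hrk hk.le
    rw [show k * (0.9 * k⁻¹ / 100) = 0.009 * (k * k⁻¹) by ring, mul_inv_cancel₀ hk.ne', mul_one] at this
    exact this
  set V := volume (ball (0 : ℝ³) 1) with hV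
  -- Cauchy–Schwarz on `B(x, 4r)`: `∫|u| ≤ |B|^{1/2} ‖u‖_{L²}`
  have hCS : ∫⁻ w in ball x (4 * r), ‖u w‖ₑ ≤
      (ENNReal.ofReal ((4 * r) ^ 3) * V) ^ (1 / 2 : ℝ) * (∫⁻ w, ‖u w‖ₑ ^ 2) ^ (1 / 2 : ℝ) := by
    have h := ENNReal.lintegral_mul_le_Lp_mul_Lq (volume.restrict (ball x (4 * r)))
      Real.HolderConjugate.two_two (f := fun _ => (1 : ℝ≥0∞)) (g := fun w => ‖u w‖ₑ)
      aemeasurable_const hu.aemeasurable.enorm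
    simp only [Pi.mul_apply, one_mul, setLIntegral_const, ENNReal.rpow_two, one_pow] at h
    rw [Measure.addHaar_ball volume x (by positivity : (0 : ℝ) ≤ 4 * r), finrank_euclideanSpace_fin] at h
    refine h.trans (mul_le_mul' (le_of_eq rfl) (ENNReal.rpow_le_rpow (lintegral_mono_set (subset_univ _)
      |>.trans (le_of_eq ?_)) (by norm_num)))
    rw [Measure.restrict_univ]
  -- weight on the big ball
  have hE : ∫⁻ y in ball x r, ‖curl u y‖ₑ ^ 2 ≤ ENNReal.ofReal ((0.891 : ℝ)⁻¹) *
      ∫⁻ y in ball x r, ‖curl u y‖ₑ ^ 2 * ENNReal.ofReal (annularRamp k a b ‖y - x₀‖) := by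
    rw [← lintegral_const_mul' _ _ ENNReal.ofReal_ne_top]
    refine setLIntegral_mono' measurableSet_ball fun y hy => ?_
    have hη := ofReal_le_annularRamp_of_big hk hbig hy
    calc ‖curl u y‖ₑ ^ 2 = ENNReal.ofReal ((0.891 : ℝ)⁻¹) * (ENNReal.ofReal 0.891 * ‖curl u y‖ₑ ^ 2) := by
          rw [← mul_assoc, ← ENNReal.ofReal_mul (by norm_num), inv_mul_cancel₀ (by norm_num),
            ENNReal.ofReal_one, one_mul]
      _ ≤ ENNReal.ofReal ((0.891 : ℝ)⁻¹) * (ENNReal.ofReal (annularRamp k a b ‖y - x₀‖) * ‖curl u y‖ₑ ^ 2) :=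
          mul_le_mul' le_rfl (mul_le_mul' hη le_rfl)
      _ = _ := by ring
  -- coefficient algebra: `k r · C r⁻⁴ · (64 r³)^{1/2} · 0.891⁻¹ ≤ 8 C 0.009^{-3/2} 0.891⁻¹ k^{5/2}`
  have hsq : (ENNReal.ofReal ((4 * r) ^ 3) * V) ^ (1 / 2 : ℝ) =
      ENNReal.ofReal (8 * r ^ (3 / 2 : ℝ)) * V ^ (1 / 2 : ℝ) := by
    rw [ENNReal.mul_rpow_of_nonneg _ _ (by norm_num), ENNReal.ofReal_rpow_of_nonneg (by positivity)
      (by norm_num)]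
    congr 2
    have h4 : (4 : ℝ) ^ (3 / 2 : ℝ) = 8 := by
      rw [show (4 : ℝ) = (2 : ℝ) ^ (2 : ℝ) by norm_num, ← Real.rpow_mul (by norm_num)]; norm_num
    calc (((4 : ℝ) * r) ^ 3) ^ (1 / 2 : ℝ) = ((4 * r) ^ (3 : ℝ)) ^ (1 / 2 : ℝ) := by norm_cast
      _ = (4 * r) ^ (3 / 2 : ℝ) := by rw [← Real.rpow_mul (by positivity)]; norm_num
      _ = (4 : ℝ) ^ (3 / 2 : ℝ) * r ^ (3 / 2 : ℝ) := Real.mul_rpow (by norm_num) hρ.le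
      _ = 8 * r ^ (3 / 2 : ℝ) := by rw [h4]
  have hcoef : ENNReal.ofReal (k * r) * ENNReal.ofReal (C * r⁻¹ ^ 4) * ENNReal.ofReal (8 * r ^ (3 / 2 : ℝ)) *
      ENNReal.ofReal ((0.891 : ℝ)⁻¹) ≤
      ENNReal.ofReal (8 * C * (0.009 : ℝ) ^ (-(3 / 2) : ℝ) * (0.891 : ℝ)⁻¹ * k ^ (5 / 2 : ℝ)) := by
    rw [← ENNReal.ofReal_mul (by positivity), ← ENNReal.ofReal_mul (by positivity),
      ← ENNReal.ofReal_mul (by positivity)]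
    refine ENNReal.ofReal_le_ofReal ?_
    -- reduce to `(k r)^{-3/2} ≤ 0.009^{-3/2}`
    have hkr' : (k * r) ^ (-(3 / 2) : ℝ) ≤ (0.009 : ℝ) ^ (-(3 / 2) : ℝ) := by
      rw [Real.rpow_neg (by positivity), Real.rpow_neg (by norm_num)]
      exact inv_anti₀ (by positivity) (Real.rpow_le_rpow (by norm_num) hkr (by norm_num))
    have e : k * r * (C * r⁻¹ ^ 4) * (8 * r ^ (3 / 2 : ℝ)) * (0.891 : ℝ)⁻¹ =
        8 * C * (0.891 : ℝ)⁻¹ * k ^ (5 / 2 : ℝ) * (k * r) ^ (-(3 / 2) : ℝ) := by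
      rw [Real.mul_rpow hk.le hρ.le]
      have e1 : k * k ^ (-(3 / 2) : ℝ) = k ^ (5 / 2 : ℝ) * k ^ (-(3 : ℝ)) := by
        rw [show k * k ^ (-(3 / 2) : ℝ) = k ^ (1 : ℝ) * k ^ (-(3 / 2) : ℝ) by rw [Real.rpow_one],
          ← Real.rpow_add hk, ← Real.rpow_add hk]; norm_num
      have e2 : r * r⁻¹ ^ 4 * r ^ (3 / 2 : ℝ) = r ^ (-(3 / 2) : ℝ) := by
        rw [inv_pow, ← Real.rpow_natCast r 4, ← Real.rpow_neg hρ.le,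
          show r * r ^ (-((4 : ℕ) : ℝ)) * r ^ (3 / 2 : ℝ) = r ^ (1 : ℝ) * r ^ (-((4 : ℕ) : ℝ)) * r ^ (3 / 2 : ℝ)
            by rw [Real.rpow_one], ← Real.rpow_add hρ, ← Real.rpow_add hρ]
        norm_num
      have e3 : k ^ (-(3 : ℝ)) * k ^ (3 : ℝ) = 1 := by rw [← Real.rpow_add hk]; norm_num
      calc k * r * (C * r⁻¹ ^ 4) * (8 * r ^ (3 / 2 : ℝ)) * (0.891 : ℝ)⁻¹
          = 8 * C * (0.891 : ℝ)⁻¹ * k * (r * r⁻¹ ^ 4 * r ^ (3 / 2 : ℝ)) := by ring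
        _ = 8 * C * (0.891 : ℝ)⁻¹ * k * r ^ (-(3 / 2) : ℝ) := by rw [e2]
        _ = 8 * C * (0.891 : ℝ)⁻¹ * (k * k ^ (-(3 / 2) : ℝ)) * (k ^ (3 / 2 : ℝ) * r ^ (-(3 / 2) : ℝ)) := by
            have : k * k ^ (-(3 / 2) : ℝ) * k ^ (3 / 2 : ℝ) = k := by
              rw [mul_assoc, ← Real.rpow_add hk]; norm_num
            calc 8 * C * (0.891 : ℝ)⁻¹ * k * r ^ (-(3 / 2) : ℝ)
                = 8 * C * (0.891 : ℝ)⁻¹ * (k * k ^ (-(3 / 2) : ℝ) * k ^ (3 / 2 : ℝ)) * r ^ (-(3 / 2) : ℝ) := by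
                  rw [this]
              _ = _ := by ring
        _ = 8 * C * (0.891 : ℝ)⁻¹ * (k * k ^ (-(3 / 2) : ℝ)) * k ^ (3 : ℝ) *
              (k ^ (-(3 / 2) : ℝ) * r ^ (-(3 / 2) : ℝ)) := by
            have : k ^ (3 / 2 : ℝ) = k ^ (3 : ℝ) * k ^ (-(3 / 2) : ℝ) := by
              rw [← Real.rpow_add hk]; norm_num
            rw [this]; ring
        _ = 8 * C * (0.891 : ℝ)⁻¹ * k ^ (5 / 2 : ℝ) * (k ^ (-(3 : ℝ)) * k ^ (3 : ℝ)) *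
              (k ^ (-(3 / 2) : ℝ) * r ^ (-(3 / 2) : ℝ)) := by rw [e1]; ring
        _ = _ := by rw [e3, mul_one]
    rw [e]
    have h0 : 0 ≤ 8 * C * (0.891 : ℝ)⁻¹ * k ^ (5 / 2 : ℝ) := by positivity
    calc 8 * C * (0.891 : ℝ)⁻¹ * k ^ (5 / 2 : ℝ) * (k * r) ^ (-(3 / 2) : ℝ)
        ≤ 8 * C * (0.891 : ℝ)⁻¹ * k ^ (5 / 2 : ℝ) * (0.009 : ℝ) ^ (-(3 / 2) : ℝ) :=
          mul_le_mul_of_nonneg_left hkr' h0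
      _ = _ := by ring
  calc ENNReal.ofReal (k * r) * (ENNReal.ofReal (C * r⁻¹ ^ 4) * (∫⁻ w in ball x (4 * r), ‖u w‖ₑ) *
        ∫⁻ y in ball x r, ‖curl u y‖ₑ ^ 2)
      ≤ ENNReal.ofReal (k * r) * (ENNReal.ofReal (C * r⁻¹ ^ 4) *
          (ENNReal.ofReal (8 * r ^ (3 / 2 : ℝ)) * V ^ (1 / 2 : ℝ) * (∫⁻ w, ‖u w‖ₑ ^ 2) ^ (1 / 2 : ℝ)) *
          (ENNReal.ofReal ((0.891 : ℝ)⁻¹) *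
            ∫⁻ y in ball x r, ‖curl u y‖ₑ ^ 2 * ENNReal.ofReal (annularRamp k a b ‖y - x₀‖))) := by
        refine mul_le_mul' le_rfl (mul_le_mul' (mul_le_mul' le_rfl ?_) hE)
        rw [← hsq]; exact hCS
    _ = (ENNReal.ofReal (k * r) * ENNReal.ofReal (C * r⁻¹ ^ 4) * ENNReal.ofReal (8 * r ^ (3 / 2 : ℝ)) *
          ENNReal.ofReal ((0.891 : ℝ)⁻¹)) * V ^ (1 / 2 : ℝ) * (∫⁻ w, ‖u w‖ₑ ^ 2) ^ (1 / 2 : ℝ) *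
          ∫⁻ y in ball x r, ‖curl u y‖ₑ ^ 2 * ENNReal.ofReal (annularRamp k a b ‖y - x₀‖) := by ring
    _ ≤ _ := mul_le_mul' (mul_le_mul' (mul_le_mul' hcoef le_rfl) le_rfl) le_rfl


/-- `|B(x,ρ)|^{1/6} = ρ^{1/2} |B₁|^{1/6}` (the tree's `TaoY6BallEstimate.volume_ball_rpow_sixth` up to the
`ofReal`/`rpow` normalisation; that file is deliberately not imported here). [folklore] -/
theorem volume_ball_rpow_sixth' (x : ℝ³) {r : ℝ} (hr : 0 < r) :
    (volume (ball x r)) ^ (1 / 6 : ℝ) = ENNReal.ofReal (r ^ (1 / 2 : ℝ)) * (volume (ball (0 : ℝ³) 1)) ^ (1 / 6 : ℝ) := by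
  rw [Measure.addHaar_ball volume x hr.le, finrank_euclideanSpace_fin, ENNReal.mul_rpow_of_nonneg _ _
    (by norm_num : (0 : ℝ) ≤ 1 / 6), ENNReal.ofReal_rpow_of_nonneg (by positivity) (by norm_num)]
  congr 2
  rw [show r ^ 3 = r ^ (3 : ℝ) by norm_cast, ← Real.rpow_mul hr.le]
  norm_num

/-- **The `Y₆,₁` factor on one ball, after Sobolev**: with `Sx = K(G + C_S ρ⁻² A₃)`, `Φ ≤ C_E A₉`,
`101kρ · Sx Φ^{1/2} |B|^{1/6} ≤ 101 K C_E^{1/2}|B₁|^{1/6} (kρ^{3/2} G A₉^{1/2} + C_S k ρ⁴ m³)`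
(Tao's (10.21): "`Y₆,₁ ≲ c^{-0.1}δ² Σᵢ rᵢ³wᵢ‖∇ω‖²_{L²(3Bᵢ)} + c^{-0.1}δ² Σᵢ rᵢ⁴wᵢ³`"). [cite: Tao2011, §10, proof of Thm. 10.1 ((10.21), p. 32)] -/
theorem term1_le {ω : ℝ³ → ℝ³} {x : ℝ³} {r k : ℝ} (hk : 0 < k) (hr : 0 < r) {K CS CE : ℝ≥0∞}
    {G A3 Φ : ℝ≥0∞} (hA3 : A3 ≤ ∫⁻ y in ball x (9 * r), ‖ω y‖ₑ ^ 2)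
    (hΦ : Φ ≤ CE * ∫⁻ y in ball x (9 * r), ‖ω y‖ₑ ^ 2) :
    ENNReal.ofReal (101 * k * r) * (K * (G + CS * ENNReal.ofReal (r⁻¹ ^ 2) * A3) * Φ ^ (1 / 2 : ℝ) *
        (volume (ball x r)) ^ (1 / 6 : ℝ)) ≤
      101 * K * CE ^ (1 / 2 : ℝ) * (volume (ball (0 : ℝ³) 1)) ^ (1 / 6 : ℝ) *
        (ENNReal.ofReal (k * r ^ (3 / 2 : ℝ)) * G * (∫⁻ y in ball x (9 * r), ‖ω y‖ₑ ^ 2) ^ (1 / 2 : ℝ) +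
          CS * ENNReal.ofReal k * (ENNReal.ofReal (r ^ 4) * rms ω x r ^ 3)) := by
  set A9 := ∫⁻ y in ball x (9 * r), ‖ω y‖ₑ ^ 2 with hA9
  set V := volume (ball (0 : ℝ³) 1) with hV
  have hΦ2 : Φ ^ (1 / 2 : ℝ) ≤ CE ^ (1 / 2 : ℝ) * A9 ^ (1 / 2 : ℝ) := by
    rw [← ENNReal.mul_rpow_of_nonneg _ _ (by norm_num)]
    exact ENNReal.rpow_le_rpow hΦ (by norm_num)
  rw [volume_ball_rpow_sixth' x hr, ← hV, ofReal_pow_four_mul_rms_pow_three hr, ← hA9, rms_def, ← hA9]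
  have h101 : ENNReal.ofReal (101 * k * r) = 101 * ENNReal.ofReal (k * r) := by
    rw [mul_assoc, ENNReal.ofReal_mul (by norm_num), ENNReal.ofReal_ofNat]
  rw [h101]
  -- coefficient identities
  have e1 : ENNReal.ofReal (k * r) * ENNReal.ofReal (r ^ (1 / 2 : ℝ)) = ENNReal.ofReal (k * r ^ (3 / 2 : ℝ)) := by
    rw [← ENNReal.ofReal_mul (by positivity), mul_assoc,
      show r * r ^ (1 / 2 : ℝ) = r ^ (1 : ℝ) * r ^ (1 / 2 : ℝ) by rw [Real.rpow_one], ← Real.rpow_add hr]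
    norm_num
  have e2 : ENNReal.ofReal (k * r) * ENNReal.ofReal (r⁻¹ ^ 2) * ENNReal.ofReal (r ^ (1 / 2 : ℝ)) =
      ENNReal.ofReal k * (ENNReal.ofReal r * ENNReal.ofReal (r ^ (-(3 / 2) : ℝ))) := by
    rw [← ENNReal.ofReal_mul (by positivity), ← ENNReal.ofReal_mul (by positivity),
      ← ENNReal.ofReal_mul hr.le, ← ENNReal.ofReal_mul hk.le]
    congr 1
    rw [inv_pow, ← Real.rpow_natCast r 2, ← Real.rpow_neg hr.le]
    have : r * r ^ (-((2 : ℕ) : ℝ)) * r ^ (1 / 2 : ℝ) = r * r ^ (-(3 / 2) : ℝ) := by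
      rw [show r * r ^ (-((2 : ℕ) : ℝ)) * r ^ (1 / 2 : ℝ) = r ^ (1 : ℝ) * r ^ (-((2 : ℕ) : ℝ)) * r ^ (1 / 2 : ℝ)
          by rw [Real.rpow_one],
        show r * r ^ (-(3 / 2) : ℝ) = r ^ (1 : ℝ) * r ^ (-(3 / 2) : ℝ) by rw [Real.rpow_one],
        ← Real.rpow_add hr, ← Real.rpow_add hr, ← Real.rpow_add hr]
      norm_num
    calc k * r * r ^ (-((2 : ℕ) : ℝ)) * r ^ (1 / 2 : ℝ) = k * (r * r ^ (-((2 : ℕ) : ℝ)) * r ^ (1 / 2 : ℝ)) := by ring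
      _ = k * (r * r ^ (-(3 / 2) : ℝ)) := by rw [this]
  calc 101 * ENNReal.ofReal (k * r) * (K * (G + CS * ENNReal.ofReal (r⁻¹ ^ 2) * A3) * Φ ^ (1 / 2 : ℝ) *
        (ENNReal.ofReal (r ^ (1 / 2 : ℝ)) * V ^ (1 / 6 : ℝ)))
      ≤ 101 * ENNReal.ofReal (k * r) * (K * (G + CS * ENNReal.ofReal (r⁻¹ ^ 2) * A9) *
          (CE ^ (1 / 2 : ℝ) * A9 ^ (1 / 2 : ℝ)) * (ENNReal.ofReal (r ^ (1 / 2 : ℝ)) * V ^ (1 / 6 : ℝ))) := by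
        gcongr
    _ = 101 * K * CE ^ (1 / 2 : ℝ) * V ^ (1 / 6 : ℝ) *
          ((ENNReal.ofReal (k * r) * ENNReal.ofReal (r ^ (1 / 2 : ℝ))) * G * A9 ^ (1 / 2 : ℝ) +
            CS * ((ENNReal.ofReal (k * r) * ENNReal.ofReal (r⁻¹ ^ 2) * ENNReal.ofReal (r ^ (1 / 2 : ℝ))) *
              A9 * A9 ^ (1 / 2 : ℝ))) := by ring
    _ = _ := by rw [e1, e2]; ring


/-- **The `Y₆` estimate over the whole annulus, generic slope `k`** (Tao 2011, pp. 32–33, all of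
the estimates (10.19)–(10.24) assembled on a discrete Whitney family): there is an absolute constant
`K₀ < ∞` such that for every annulus `{a < |x − x₀| < b}` (`a > 0`, `a + 2k⁻¹ < b`), every
divergence-free `u ∈ C⁴(ℝ³; ℝ³)` with `|u| ≤ s`, and `ω = curl u`, `η = annularRamp k a b |· − x₀|`,
`∫ |ω|²‖Du‖η ≤ K₀ (k^{3/2}𝒲^{1/2}𝒲 + k^{-1/2}𝒲^{1/2}𝒴 + k^{5/2}‖u‖_{L²}𝒲 + ks ∫_{layers}|ω|²)`
with `𝒲 = ∫|ω|²η`, `𝒴 = ∫‖∇ω‖²η` (Tao: "`Y₆,₁ ≲ c^{-0.15}δ³W^{3/2} + c^{0.05}δ⁻¹W^{1/2}Y₁`",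
"`Y₆,₂ ≲ c^{0.9}Y₂ + c^{0.75}W/T`", here before the substitution `k = c^{-0.1}δ²`). [cite: Tao2011, §10, proof of Thm. 10.1 ((10.19)–(10.24), pp. 32–33)] -/
theorem lintegral_Y6_le :
    ∃ K₀ : ℝ≥0∞, K₀ ≠ ⊤ ∧ ∀ ⦃x₀ : ℝ³⦄ ⦃a b k : ℝ⦄, 0 < a → 0 < k → a + 2 * k⁻¹ < b →
      ∀ ⦃u : ℝ³ → ℝ³⦄, ContDiff ℝ 4 u → VectorCalculus.IsDivFree u →
      ∀ ⦃s : ℝ⦄, 0 ≤ s → (∀ y, ‖u y‖ ≤ s) →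
        ∫⁻ y, ‖curl u y‖ₑ ^ 2 * ‖fderiv ℝ u y‖ₑ * ENNReal.ofReal (annularRamp k a b ‖y - x₀‖) ≤
          K₀ * (ENNReal.ofReal (k ^ (3 / 2 : ℝ)) *
              (∫⁻ y, ‖curl u y‖ₑ ^ 2 * ENNReal.ofReal (annularRamp k a b ‖y - x₀‖)) ^ (1 / 2 : ℝ) *
              (∫⁻ y, ‖curl u y‖ₑ ^ 2 * ENNReal.ofReal (annularRamp k a b ‖y - x₀‖)) +
            ENNReal.ofReal (k ^ (-(1 / 2) : ℝ)) *
              (∫⁻ y, ‖curl u y‖ₑ ^ 2 * ENNReal.ofReal (annularRamp k a b ‖y - x₀‖)) ^ (1 / 2 : ℝ) *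
              (∫⁻ y, ‖fderiv ℝ (curl u) y‖ₑ ^ 2 * ENNReal.ofReal (annularRamp k a b ‖y - x₀‖)) +
            ENNReal.ofReal (k ^ (5 / 2 : ℝ)) * (∫⁻ w, ‖u w‖ₑ ^ 2) ^ (1 / 2 : ℝ) *
              (∫⁻ y, ‖curl u y‖ₑ ^ 2 * ENNReal.ofReal (annularRamp k a b ‖y - x₀‖)) +
            ENNReal.ofReal (k * s) * ∫⁻ y in {y : ℝ³ | (a < ‖y - x₀‖ ∧ ‖y - x₀‖ < a + k⁻¹) ∨
              (b - k⁻¹ < ‖y - x₀‖ ∧ ‖y - x₀‖ < b)}, ‖curl u y‖ₑ ^ 2) := by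
  classical
  -- the absolute constants
  obtain ⟨CE, hCE0, hCE⟩ := exists_local_velocityGradient_bound_ennreal
  obtain ⟨KS, CS, hKStop, hCStop, hSob⟩ := exists_lintegral_six_ball_le
  set V : ℝ≥0∞ := volume (ball (0 : ℝ³) 1) with hV
  have hVtop : V ≠ ⊤ := measure_ball_lt_top.ne
  set θ : ℝ := 2 / 101 with hθ
  set ϑ : ℝ≥0∞ := ENNReal.ofReal ((1 + θ)⁻¹) with hϑ
  have hϑ1 : ϑ < 1 := by
    rw [hϑ, ← ENNReal.ofReal_one]
    exact (ENNReal.ofReal_lt_ofReal_iff one_pos).2 (inv_lt_one_of_one_lt₀ (by norm_num))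
  set Cg : ℝ≥0∞ := ENNReal.ofReal ((4 * (5 / θ) + 5) ^ 3) with hCg
  set C₀ : ℝ≥0∞ := Cg * ∑' j : ℕ, ϑ ^ j with hC₀
  set C₁ : ℝ≥0∞ := Cg * ∑' i : ℕ, ((i : ℝ≥0∞) + 2) ^ 4 * ϑ ^ i with hC₁
  have hC₀top : C₀ ≠ ⊤ := ENNReal.mul_ne_top ENNReal.ofReal_ne_top
    (WhitneyChain.tsum_geometric_lt_top hϑ1).ne
  have hC₁top : C₁ ≠ ⊤ := ENNReal.mul_ne_top ENNReal.ofReal_ne_top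
    (WhitneyChain.tsum_pow_four_mul_geometric_lt_top hϑ1).ne
  -- k-free coefficients of the four monomials
  set c148 : ℝ≥0∞ := ENNReal.ofReal ((148 : ℝ) ^ (3 / 2 : ℝ)) with hc148
  set α₁ : ℝ≥0∞ := 101 * KS * ENNReal.ofReal CE ^ (1 / 2 : ℝ) * V ^ (1 / 6 : ℝ) with hα₁
  set cA : ℝ≥0∞ := ENNReal.ofReal ((91 : ℝ)⁻¹ ^ (1 / 2 : ℝ) * 97⁻¹) * c148 * ENNReal.ofReal (52 ^ 3)
    with hcA
  set cB : ℝ≥0∞ := (1 + 8 * C₀) * ENNReal.ofReal ((91 : ℝ)⁻¹ ^ (1 / 2 : ℝ) / (0.819 * 0.009)) * c148 *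
    ENNReal.ofReal (148 ^ 3) with hcB
  set cC : ℝ≥0∞ := 8 * C₁ * (8 * ENNReal.ofReal (2 * (Real.sqrt 32 * 15)) ^ 2 *
    ENNReal.ofReal ((91 : ℝ)⁻¹ ^ (1 / 2 : ℝ))) * c148 * ENNReal.ofReal ((85 : ℝ)⁻¹) *
    ENNReal.ofReal (244 ^ 3) with hcC
  set cD : ℝ≥0∞ := 101 * (ENNReal.ofReal (64 * CE) * V) * ENNReal.ofReal (20 ^ 3) with hcD
  set cF : ℝ≥0∞ := 101 * (ENNReal.ofReal (8 * CE * (0.009 : ℝ) ^ (-(3 / 2) : ℝ) * (0.891 : ℝ)⁻¹) *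
    V ^ (1 / 2 : ℝ)) * ENNReal.ofReal (20 ^ 3) with hcF
  set K₀ : ℝ≥0∞ := α₁ * cA + α₁ * CS * cB + α₁ * CS * cC + cD + cF with hK₀
  have hα₁top : α₁ ≠ ⊤ := by
    refine ENNReal.mul_ne_top (ENNReal.mul_ne_top (ENNReal.mul_ne_top (by norm_num) hKStop)
      (ENNReal.rpow_ne_top_of_nonneg (by norm_num) ENNReal.ofReal_ne_top))
      (ENNReal.rpow_ne_top_of_nonneg (by norm_num) hVtop)
  have hc148top : c148 ≠ ⊤ := ENNReal.ofReal_ne_top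
  refine ⟨K₀, ?_, ?_⟩
  · refine ENNReal.add_ne_top.2 ⟨ENNReal.add_ne_top.2 ⟨ENNReal.add_ne_top.2 ⟨ENNReal.add_ne_top.2 ⟨?_, ?_⟩,
      ?_⟩, ?_⟩, ?_⟩
    · exact ENNReal.mul_ne_top hα₁top (ENNReal.mul_ne_top (ENNReal.mul_ne_top ENNReal.ofReal_ne_top
        hc148top) ENNReal.ofReal_ne_top)
    · refine ENNReal.mul_ne_top (ENNReal.mul_ne_top hα₁top hCStop) ?_
      exact ENNReal.mul_ne_top (ENNReal.mul_ne_top (ENNReal.mul_ne_top (ENNReal.add_ne_top.2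
        ⟨ENNReal.one_ne_top, ENNReal.mul_ne_top (by norm_num) hC₀top⟩) ENNReal.ofReal_ne_top) hc148top)
        ENNReal.ofReal_ne_top
    · refine ENNReal.mul_ne_top (ENNReal.mul_ne_top hα₁top hCStop) ?_
      refine ENNReal.mul_ne_top (ENNReal.mul_ne_top (ENNReal.mul_ne_top (ENNReal.mul_ne_top
        (ENNReal.mul_ne_top (by norm_num) hC₁top) ?_) hc148top) ENNReal.ofReal_ne_top) ENNReal.ofReal_ne_top
      exact ENNReal.mul_ne_top (ENNReal.mul_ne_top (by norm_num) (ENNReal.pow_ne_top ENNReal.ofReal_ne_top))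
        ENNReal.ofReal_ne_top
    · exact ENNReal.mul_ne_top (ENNReal.mul_ne_top (by norm_num) (ENNReal.mul_ne_top ENNReal.ofReal_ne_top
        hVtop)) ENNReal.ofReal_ne_top
    · exact ENNReal.mul_ne_top (ENNReal.mul_ne_top (by norm_num) (ENNReal.mul_ne_top ENNReal.ofReal_ne_top
        (ENNReal.rpow_ne_top_of_nonneg (by norm_num) hVtop))) ENNReal.ofReal_ne_top
  intro x₀ a b k ha hk hab u hu hdiv s hs0 hs
  -- regularity
  have hu1 : ContDiff ℝ 1 u := hu.of_le (by norm_cast)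
  have hω3 : ContDiff ℝ 3 (curl u) := contDiff_curl (n := 3) (by exact_mod_cast hu)
  have hω1 : ContDiff ℝ 1 (curl u) := hω3.of_le (by norm_cast)
  have hωc : Continuous (curl u) := hω1.continuous
  have hDωc : Continuous (fderiv ℝ (curl u)) := hω1.continuous_fderiv one_ne_zero
  have hDuc : Continuous (fderiv ℝ u) := hu1.continuous_fderiv one_ne_zero
  have hηc : Continuous fun y : ℝ³ => annularRamp k a b ‖y - x₀‖ :=
    (continuous_annularRamp hk.le a b).comp (continuous_id.sub continuous_const).norm
  have hηm : Measurable fun y : ℝ³ => ENNReal.ofReal (annularRamp k a b ‖y - x₀‖) :=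
    ENNReal.measurable_ofReal.comp hηc.measurable
  -- abbreviations
  set ηf : ℝ³ → ℝ≥0∞ := fun y => ENNReal.ofReal (annularRamp k a b ‖y - x₀‖) with hηf
  set 𝒲 := ∫⁻ y, ‖curl u y‖ₑ ^ 2 * ηf y with h𝒲
  set 𝒴 := ∫⁻ y, ‖fderiv ℝ (curl u) y‖ₑ ^ 2 * ηf y with h𝒴
  set 𝒰 := (∫⁻ w, ‖u w‖ₑ ^ 2) ^ (1 / 2 : ℝ) with h𝒰
  set Λ := ∫⁻ y in {y : ℝ³ | (a < ‖y - x₀‖ ∧ ‖y - x₀‖ < a + k⁻¹) ∨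
      (b - k⁻¹ < ‖y - x₀‖ ∧ ‖y - x₀‖ < b)}, ‖curl u y‖ₑ ^ 2 with hΛ
  set 𝒲ₜ := ENNReal.ofReal (148 ^ 3) * 𝒲 with h𝒲ₜ
  set ρ := whitneyRadius x₀ a b k with hρ
  set f : ℝ³ → ℝ≥0∞ := fun y => ‖curl u y‖ₑ ^ 2 * ‖fderiv ℝ u y‖ₑ * ηf y with hf
  -- the Whitney family
  obtain ⟨S, hW⟩ := exists_isWhitneyFamily (r := ρ) (Ω := {x : ℝ³ | 0 < annDepth x₀ a b x})
    (fun x hx => whitneyRadius_pos hk hx) (R := k⁻¹ / 100) (fun x _ => whitneyRadius_le_inv_div hk x)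
  -- Step 0: reduce to the annulus and cover
  have hLHS : ∫⁻ y, f y = ∫⁻ y in {x : ℝ³ | 0 < annDepth x₀ a b x}, f y := by
    have hΩ : MeasurableSet {x : ℝ³ | 0 < annDepth x₀ a b x} :=
      (isOpen_lt continuous_const (continuous_annDepth x₀ a b)).measurableSet
    rw [← lintegral_indicator hΩ]
    refine lintegral_congr fun y => ?_
    by_cases hy : y ∈ {x : ℝ³ | 0 < annDepth x₀ a b x}
    · rw [indicator_of_mem hy]
    · rw [indicator_of_notMem hy, hf]
      simp only [hηf]
      rw [annularRamp_norm_sub_eq_zero_of_annDepth_nonpos hk.le (not_lt.1 hy), ENNReal.ofReal_zero, mul_zero]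
  have hcov := setLIntegral_le_tsum_of_cover volume hW.countable hW.cover f
  -- Step 1: the estimate on each ball of the family
  have hball : ∀ x : S, ∫⁻ y in ball (x : ℝ³) (ρ x), f y ≤
      α₁ * (ENNReal.ofReal (k * ρ x ^ (3 / 2 : ℝ)) * (∫⁻ y in ball (x : ℝ³) (3 * ρ x), ‖fderiv ℝ (curl u) y‖ₑ ^ 2) *
          (∫⁻ y in ball (x : ℝ³) (9 * ρ x), ‖curl u y‖ₑ ^ 2) ^ (1 / 2 : ℝ) +
        CS * ENNReal.ofReal k * (ENNReal.ofReal (ρ x ^ 4) * rms (curl u) x (ρ x) ^ 3)) +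
      101 * (ENNReal.ofReal (k * ρ x) * (ENNReal.ofReal (CE * (ρ x)⁻¹ ^ 4) *
        (∫⁻ w in ball (x : ℝ³) (4 * ρ x), ‖u w‖ₑ) * ∫⁻ y in ball (x : ℝ³) (ρ x), ‖curl u y‖ₑ ^ 2)) := by
    intro x
    have hx : 0 < annDepth x₀ a b (x : ℝ³) := hW.subset x.2
    have hρx : 0 < ρ x := whitneyRadius_pos hk hx
    obtain ⟨F, hFm, hF2, hFpt⟩ := hCE hu hdiv (x : ℝ³) hρx
    have hS := hSob hω1 (x : ℝ³) hρx
    have hT := setLIntegral_whitneyBall_le (x₀ := x₀) (a := a) (b := b) hk hu1 hx hFm hFpt hS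
    have h1 := term1_le (ω := curl u) (x := (x : ℝ³)) hk hρx (K := KS) (CS := CS) (CE := ENNReal.ofReal CE)
      (G := ∫⁻ y in ball (x : ℝ³) (3 * ρ x), ‖fderiv ℝ (curl u) y‖ₑ ^ 2)
      (A3 := ∫⁻ y in ball (x : ℝ³) (3 * ρ x), ‖curl u y‖ₑ ^ 2) (Φ := ∫⁻ y, F y ^ 2)
      (lintegral_mono_set (ball_subset_ball (by linarith))) hF2
    have h101 : ENNReal.ofReal (101 * k * ρ x) = 101 * ENNReal.ofReal (k * ρ x) := by
      rw [mul_assoc, ENNReal.ofReal_mul (by norm_num), ENNReal.ofReal_ofNat]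
    refine hT.trans ?_
    rw [mul_add]
    refine add_le_add h1 ?_
    rw [h101, mul_assoc]
  -- Step 2: the four sums
  have hmeasW : AEMeasurable (fun y => ‖curl u y‖ₑ ^ 2 * ηf y) volume :=
    (hωc.aemeasurable.enorm.pow_const 2).mul hηm.aemeasurable
  have hmeasY : AEMeasurable (fun y => ‖fderiv ℝ (curl u) y‖ₑ ^ 2 * ηf y) volume :=
    (hDωc.aemeasurable.enorm.pow_const 2).mul hηm.aemeasurable
  have hlayerm : MeasurableSet {y : ℝ³ | (a < ‖y - x₀‖ ∧ ‖y - x₀‖ < a + k⁻¹) ∨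
      (b - k⁻¹ < ‖y - x₀‖ ∧ ‖y - x₀‖ < b)} := by
    rw [← setOf_annDepth_lt_eq (x₀ := x₀) hk hab]
    exact ((isOpen_lt continuous_const (continuous_annDepth x₀ a b)).inter
      (isOpen_lt (continuous_annDepth x₀ a b) continuous_const)).measurableSet
  have hmeasL : AEMeasurable (fun y => ‖curl u y‖ₑ ^ 2 * {y : ℝ³ | (a < ‖y - x₀‖ ∧ ‖y - x₀‖ < a + k⁻¹) ∨
      (b - k⁻¹ < ‖y - x₀‖ ∧ ‖y - x₀‖ < b)}.indicator 1 y) volume :=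
    (hωc.aemeasurable.enorm.pow_const 2).mul ((measurable_const.indicator hlayerm).aemeasurable)
  -- (a) Σ t1a
  have hsumA : ∑' x : S, ENNReal.ofReal (k * ρ x ^ (3 / 2 : ℝ)) *
      (∫⁻ y in ball (x : ℝ³) (3 * ρ x), ‖fderiv ℝ (curl u) y‖ₑ ^ 2) *
        (∫⁻ y in ball (x : ℝ³) (9 * ρ x), ‖curl u y‖ₑ ^ 2) ^ (1 / 2 : ℝ) ≤
      ENNReal.ofReal ((91 : ℝ)⁻¹ ^ (1 / 2 : ℝ) * 97⁻¹ * k ^ (-(1 / 2) : ℝ)) * 𝒲ₜ ^ (1 / 2 : ℝ) *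
        (ENNReal.ofReal (52 ^ 3) * 𝒴) := by
    have hov := tsum_setLIntegral_whitneyBall_le hW hk (by norm_num : (0:ℝ) ≤ 3) (by norm_num) hmeasY
    calc ∑' x : S, ENNReal.ofReal (k * ρ x ^ (3 / 2 : ℝ)) *
          (∫⁻ y in ball (x : ℝ³) (3 * ρ x), ‖fderiv ℝ (curl u) y‖ₑ ^ 2) *
            (∫⁻ y in ball (x : ℝ³) (9 * ρ x), ‖curl u y‖ₑ ^ 2) ^ (1 / 2 : ℝ)
        ≤ ∑' x : S, ENNReal.ofReal ((91 : ℝ)⁻¹ ^ (1 / 2 : ℝ) * 97⁻¹ * k ^ (-(1 / 2) : ℝ)) * 𝒲ₜ ^ (1 / 2 : ℝ) *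
            ∫⁻ y in ball (x : ℝ³) (3 * ρ x), ‖fderiv ℝ (curl u) y‖ₑ ^ 2 * ηf y :=
          ENNReal.tsum_le_tsum fun x => term1a_le hW hk hωc x.2 _
      _ = ENNReal.ofReal ((91 : ℝ)⁻¹ ^ (1 / 2 : ℝ) * 97⁻¹ * k ^ (-(1 / 2) : ℝ)) * 𝒲ₜ ^ (1 / 2 : ℝ) *
            ∑' x : S, ∫⁻ y in ball (x : ℝ³) (3 * ρ x), ‖fderiv ℝ (curl u) y‖ₑ ^ 2 * ηf y :=
          ENNReal.tsum_mul_left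
      _ ≤ _ := mul_le_mul' le_rfl (hov.trans (le_of_eq (by norm_num; rfl)))
  -- (b) Σ ρ⁴m³ (the chain)
  obtain ⟨C₀', C₁', -, -, hC₀', hC₁', hsumB⟩ := tsum_pow_four_rms_le (x₀ := x₀) ha hk hab hW hω1
  have eC₀ : C₀' = C₀ := hC₀'
  have eC₁ : C₁' = C₁ := hC₁'
  rw [eC₀, eC₁] at hsumB
  -- (c) Σ term2
  have hsumC : ∑' x : S, ENNReal.ofReal (k * ρ x) * (ENNReal.ofReal (CE * (ρ x)⁻¹ ^ 4) *
      (∫⁻ w in ball (x : ℝ³) (4 * ρ x), ‖u w‖ₑ) * ∫⁻ y in ball (x : ℝ³) (ρ x), ‖curl u y‖ₑ ^ 2) ≤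
      ENNReal.ofReal (64 * CE * k * s) * V * (ENNReal.ofReal (20 ^ 3) * (∫⁻ y, ‖curl u y‖ₑ ^ 2 *
        {y : ℝ³ | (a < ‖y - x₀‖ ∧ ‖y - x₀‖ < a + k⁻¹) ∨ (b - k⁻¹ < ‖y - x₀‖ ∧ ‖y - x₀‖ < b)}.indicator 1 y)) +
      ENNReal.ofReal (8 * CE * (0.009 : ℝ) ^ (-(3 / 2) : ℝ) * (0.891 : ℝ)⁻¹ * k ^ (5 / 2 : ℝ)) *
        V ^ (1 / 2 : ℝ) * 𝒰 * (ENNReal.ofReal (20 ^ 3) * 𝒲) := by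
    have hov1 := tsum_setLIntegral_whitneyBall_le hW hk (by norm_num : (0:ℝ) ≤ 1) (by norm_num) hmeasL
    have hov2 := tsum_setLIntegral_whitneyBall_le hW hk (by norm_num : (0:ℝ) ≤ 1) (by norm_num) hmeasW
    simp only [one_mul] at hov1 hov2
    calc ∑' x : S, ENNReal.ofReal (k * ρ x) * (ENNReal.ofReal (CE * (ρ x)⁻¹ ^ 4) *
          (∫⁻ w in ball (x : ℝ³) (4 * ρ x), ‖u w‖ₑ) * ∫⁻ y in ball (x : ℝ³) (ρ x), ‖curl u y‖ₑ ^ 2)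
        ≤ ∑' x : S, (ENNReal.ofReal (64 * CE * k * s) * V * (∫⁻ y in ball (x : ℝ³) (ρ x), ‖curl u y‖ₑ ^ 2 *
            {y : ℝ³ | (a < ‖y - x₀‖ ∧ ‖y - x₀‖ < a + k⁻¹) ∨ (b - k⁻¹ < ‖y - x₀‖ ∧ ‖y - x₀‖ < b)}.indicator 1 y) +
          ENNReal.ofReal (8 * CE * (0.009 : ℝ) ^ (-(3 / 2) : ℝ) * (0.891 : ℝ)⁻¹ * k ^ (5 / 2 : ℝ)) *
            V ^ (1 / 2 : ℝ) * 𝒰 * ∫⁻ y in ball (x : ℝ³) (ρ x), ‖curl u y‖ₑ ^ 2 * ηf y) := by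
          refine ENNReal.tsum_le_tsum fun x => ?_
          have hx : 0 < annDepth x₀ a b (x : ℝ³) := hW.subset x.2
          by_cases hsm : annDepth x₀ a b (x : ℝ³) < 0.9 * k⁻¹
          · exact (term2_small_le hk hab hs0 hs hx hsm hCE0.le _).trans le_self_add
          · exact (term2_big_le (x₀ := x₀) (a := a) (b := b) hk hu.continuous (not_lt.1 hsm) hCE0.le).trans
              le_add_self
      _ = ENNReal.ofReal (64 * CE * k * s) * V * (∑' x : S, ∫⁻ y in ball (x : ℝ³) (ρ x), ‖curl u y‖ₑ ^ 2 *
            {y : ℝ³ | (a < ‖y - x₀‖ ∧ ‖y - x₀‖ < a + k⁻¹) ∨ (b - k⁻¹ < ‖y - x₀‖ ∧ ‖y - x₀‖ < b)}.indicator 1 y) +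
          ENNReal.ofReal (8 * CE * (0.009 : ℝ) ^ (-(3 / 2) : ℝ) * (0.891 : ℝ)⁻¹ * k ^ (5 / 2 : ℝ)) *
            V ^ (1 / 2 : ℝ) * 𝒰 * ∑' x : S, ∫⁻ y in ball (x : ℝ³) (ρ x), ‖curl u y‖ₑ ^ 2 * ηf y := by
          rw [ENNReal.tsum_add, ENNReal.tsum_mul_left, ENNReal.tsum_mul_left]
      _ ≤ _ := add_le_add (mul_le_mul' le_rfl (hov1.trans (le_of_eq (by norm_num))))
          (mul_le_mul' le_rfl (hov2.trans (le_of_eq (by norm_num; rfl))))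
  -- Step 3: sum the per-ball bounds
  have htot : ∫⁻ y, f y ≤ α₁ * (ENNReal.ofReal ((91 : ℝ)⁻¹ ^ (1 / 2 : ℝ) * 97⁻¹ * k ^ (-(1 / 2) : ℝ)) *
        𝒲ₜ ^ (1 / 2 : ℝ) * (ENNReal.ofReal (52 ^ 3) * 𝒴) +
      CS * ENNReal.ofReal k * ((1 + 8 * C₀) * (ENNReal.ofReal ((91 : ℝ)⁻¹ ^ (1 / 2 : ℝ) / (0.819 * 0.009) *
          k ^ (1 / 2 : ℝ)) * 𝒲ₜ ^ (1 / 2 : ℝ) * 𝒲ₜ) +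
        8 * C₁ * (8 * ENNReal.ofReal (2 * (Real.sqrt 32 * 15)) ^ 2 * ENNReal.ofReal ((91 * k)⁻¹ ^ (1 / 2 : ℝ)) *
          𝒲ₜ ^ (1 / 2 : ℝ) * (ENNReal.ofReal ((85 * k)⁻¹) * (ENNReal.ofReal (244 ^ 3) * 𝒴))))) +
      101 * (ENNReal.ofReal (64 * CE * k * s) * V * (ENNReal.ofReal (20 ^ 3) * (∫⁻ y, ‖curl u y‖ₑ ^ 2 *
        {y : ℝ³ | (a < ‖y - x₀‖ ∧ ‖y - x₀‖ < a + k⁻¹) ∨ (b - k⁻¹ < ‖y - x₀‖ ∧ ‖y - x₀‖ < b)}.indicator 1 y)) +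
      ENNReal.ofReal (8 * CE * (0.009 : ℝ) ^ (-(3 / 2) : ℝ) * (0.891 : ℝ)⁻¹ * k ^ (5 / 2 : ℝ)) *
        V ^ (1 / 2 : ℝ) * 𝒰 * (ENNReal.ofReal (20 ^ 3) * 𝒲)) := by
    rw [hLHS]
    refine hcov.trans ((ENNReal.tsum_le_tsum hball).trans ?_)
    rw [ENNReal.tsum_add, ENNReal.tsum_mul_left, ENNReal.tsum_add, ENNReal.tsum_mul_left, ENNReal.tsum_mul_left]
    exact add_le_add (mul_le_mul' le_rfl (add_le_add hsumA (mul_le_mul' le_rfl hsumB)))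
      (mul_le_mul' le_rfl hsumC)
  -- Step 4: identify the powers of `k` and the global quantities
  have hΛ' : (∫⁻ y, ‖curl u y‖ₑ ^ 2 *
      {y : ℝ³ | (a < ‖y - x₀‖ ∧ ‖y - x₀‖ < a + k⁻¹) ∨ (b - k⁻¹ < ‖y - x₀‖ ∧ ‖y - x₀‖ < b)}.indicator 1 y) = Λ := by
    rw [hΛ, ← lintegral_indicator hlayerm]
    refine lintegral_congr fun y => ?_
    by_cases hy : y ∈ {y : ℝ³ | (a < ‖y - x₀‖ ∧ ‖y - x₀‖ < a + k⁻¹) ∨ (b - k⁻¹ < ‖y - x₀‖ ∧ ‖y - x₀‖ < b)}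
    · rw [indicator_of_mem hy, indicator_of_mem hy, Pi.one_apply, mul_one]
    · rw [indicator_of_notMem hy, indicator_of_notMem hy, mul_zero]
  have h𝒲ₜ2 : 𝒲ₜ ^ (1 / 2 : ℝ) = c148 * 𝒲 ^ (1 / 2 : ℝ) := by
    rw [h𝒲ₜ, ENNReal.mul_rpow_of_nonneg _ _ (by norm_num), hc148,
      ENNReal.ofReal_rpow_of_nonneg (by positivity) (by norm_num)]
    congr 2
    rw [show ((148 : ℝ) ^ 3) = (148 : ℝ) ^ (3 : ℝ) by norm_cast, ← Real.rpow_mul (by norm_num)]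
    norm_num
  have ek1 : ENNReal.ofReal ((91 : ℝ)⁻¹ ^ (1 / 2 : ℝ) * 97⁻¹ * k ^ (-(1 / 2) : ℝ)) =
      ENNReal.ofReal ((91 : ℝ)⁻¹ ^ (1 / 2 : ℝ) * 97⁻¹) * ENNReal.ofReal (k ^ (-(1 / 2) : ℝ)) :=
    ENNReal.ofReal_mul (by positivity)
  have ek2 : ENNReal.ofReal k * ENNReal.ofReal ((91 : ℝ)⁻¹ ^ (1 / 2 : ℝ) / (0.819 * 0.009) * k ^ (1 / 2 : ℝ)) =
      ENNReal.ofReal ((91 : ℝ)⁻¹ ^ (1 / 2 : ℝ) / (0.819 * 0.009)) * ENNReal.ofReal (k ^ (3 / 2 : ℝ)) := by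
    rw [← ENNReal.ofReal_mul hk.le, ← ENNReal.ofReal_mul (by positivity)]
    congr 1
    have : k * k ^ (1 / 2 : ℝ) = k ^ (3 / 2 : ℝ) := by
      rw [show k * k ^ (1 / 2 : ℝ) = k ^ (1 : ℝ) * k ^ (1 / 2 : ℝ) by rw [Real.rpow_one], ← Real.rpow_add hk]
      norm_num
    calc k * ((91 : ℝ)⁻¹ ^ (1 / 2 : ℝ) / (0.819 * 0.009) * k ^ (1 / 2 : ℝ))
        = (91 : ℝ)⁻¹ ^ (1 / 2 : ℝ) / (0.819 * 0.009) * (k * k ^ (1 / 2 : ℝ)) := by ring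
      _ = _ := by rw [this]
  have ek3 : ENNReal.ofReal k * ENNReal.ofReal ((91 * k)⁻¹ ^ (1 / 2 : ℝ)) * ENNReal.ofReal ((85 * k)⁻¹) =
      ENNReal.ofReal ((91 : ℝ)⁻¹ ^ (1 / 2 : ℝ)) * ENNReal.ofReal ((85 : ℝ)⁻¹) * ENNReal.ofReal (k ^ (-(1 / 2) : ℝ)) := by
    rw [← ENNReal.ofReal_mul hk.le, ← ENNReal.ofReal_mul (by positivity), ← ENNReal.ofReal_mul (by positivity),
      ← ENNReal.ofReal_mul (by positivity)]
    congr 1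
    rw [mul_inv, mul_inv, Real.mul_rpow (by norm_num) (by positivity), Real.inv_rpow hk.le, ← Real.rpow_neg hk.le]
    have : k * k ^ (-(1 / 2) : ℝ) * k⁻¹ = k ^ (-(1 / 2) : ℝ) := by
      field_simp
    calc k * ((91 : ℝ)⁻¹ ^ (1 / 2 : ℝ) * k ^ (-(1 / 2) : ℝ)) * ((85 : ℝ)⁻¹ * k⁻¹)
        = (91 : ℝ)⁻¹ ^ (1 / 2 : ℝ) * (85 : ℝ)⁻¹ * (k * k ^ (-(1 / 2) : ℝ) * k⁻¹) := by ring
      _ = _ := by rw [this]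
  have ek4 : ENNReal.ofReal (64 * CE * k * s) = ENNReal.ofReal (64 * CE) * ENNReal.ofReal (k * s) := by
    rw [← ENNReal.ofReal_mul (by positivity)]; ring_nf
  have ek5 : ENNReal.ofReal (8 * CE * (0.009 : ℝ) ^ (-(3 / 2) : ℝ) * (0.891 : ℝ)⁻¹ * k ^ (5 / 2 : ℝ)) =
      ENNReal.ofReal (8 * CE * (0.009 : ℝ) ^ (-(3 / 2) : ℝ) * (0.891 : ℝ)⁻¹) * ENNReal.ofReal (k ^ (5 / 2 : ℝ)) :=
    ENNReal.ofReal_mul (by positivity)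
  -- Step 5: regroup by monomials
  set M₁ := ENNReal.ofReal (k ^ (3 / 2 : ℝ)) * 𝒲 ^ (1 / 2 : ℝ) * 𝒲 with hM₁
  set M₂ := ENNReal.ofReal (k ^ (-(1 / 2) : ℝ)) * 𝒲 ^ (1 / 2 : ℝ) * 𝒴 with hM₂
  set M₃ := ENNReal.ofReal (k ^ (5 / 2 : ℝ)) * 𝒰 * 𝒲 with hM₃
  set M₄ := ENNReal.ofReal (k * s) * Λ with hM₄
  have hregroup : α₁ * (ENNReal.ofReal ((91 : ℝ)⁻¹ ^ (1 / 2 : ℝ) * 97⁻¹ * k ^ (-(1 / 2) : ℝ)) *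
        𝒲ₜ ^ (1 / 2 : ℝ) * (ENNReal.ofReal (52 ^ 3) * 𝒴) +
      CS * ENNReal.ofReal k * ((1 + 8 * C₀) * (ENNReal.ofReal ((91 : ℝ)⁻¹ ^ (1 / 2 : ℝ) / (0.819 * 0.009) *
          k ^ (1 / 2 : ℝ)) * 𝒲ₜ ^ (1 / 2 : ℝ) * 𝒲ₜ) +
        8 * C₁ * (8 * ENNReal.ofReal (2 * (Real.sqrt 32 * 15)) ^ 2 * ENNReal.ofReal ((91 * k)⁻¹ ^ (1 / 2 : ℝ)) *
          𝒲ₜ ^ (1 / 2 : ℝ) * (ENNReal.ofReal ((85 * k)⁻¹) * (ENNReal.ofReal (244 ^ 3) * 𝒴))))) +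
      101 * (ENNReal.ofReal (64 * CE * k * s) * V * (ENNReal.ofReal (20 ^ 3) * (∫⁻ y, ‖curl u y‖ₑ ^ 2 *
        {y : ℝ³ | (a < ‖y - x₀‖ ∧ ‖y - x₀‖ < a + k⁻¹) ∨ (b - k⁻¹ < ‖y - x₀‖ ∧ ‖y - x₀‖ < b)}.indicator 1 y)) +
      ENNReal.ofReal (8 * CE * (0.009 : ℝ) ^ (-(3 / 2) : ℝ) * (0.891 : ℝ)⁻¹ * k ^ (5 / 2 : ℝ)) *
        V ^ (1 / 2 : ℝ) * 𝒰 * (ENNReal.ofReal (20 ^ 3) * 𝒲)) =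
      (α₁ * CS * cB) * M₁ + (α₁ * cA + α₁ * CS * cC) * M₂ + cF * M₃ + cD * M₄ := by
    rw [hΛ', ek1, ek4, ek5, h𝒲ₜ2]
    -- isolate the two products that need `ek2`, `ek3`
    have e2 : CS * ENNReal.ofReal k * ((1 + 8 * C₀) * (ENNReal.ofReal ((91 : ℝ)⁻¹ ^ (1 / 2 : ℝ) / (0.819 * 0.009) *
          k ^ (1 / 2 : ℝ)) * (c148 * 𝒲 ^ (1 / 2 : ℝ)) * 𝒲ₜ)) =
        CS * (1 + 8 * C₀) * (ENNReal.ofReal k * ENNReal.ofReal ((91 : ℝ)⁻¹ ^ (1 / 2 : ℝ) / (0.819 * 0.009) *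
          k ^ (1 / 2 : ℝ))) * c148 * 𝒲 ^ (1 / 2 : ℝ) * 𝒲ₜ := by ring
    have e3 : CS * ENNReal.ofReal k * (8 * C₁ * (8 * ENNReal.ofReal (2 * (Real.sqrt 32 * 15)) ^ 2 *
          ENNReal.ofReal ((91 * k)⁻¹ ^ (1 / 2 : ℝ)) * (c148 * 𝒲 ^ (1 / 2 : ℝ)) *
          (ENNReal.ofReal ((85 * k)⁻¹) * (ENNReal.ofReal (244 ^ 3) * 𝒴)))) =
        CS * (8 * C₁) * (8 * ENNReal.ofReal (2 * (Real.sqrt 32 * 15)) ^ 2) *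
          (ENNReal.ofReal k * ENNReal.ofReal ((91 * k)⁻¹ ^ (1 / 2 : ℝ)) * ENNReal.ofReal ((85 * k)⁻¹)) *
          c148 * ENNReal.ofReal (244 ^ 3) * 𝒲 ^ (1 / 2 : ℝ) * 𝒴 := by ring
    rw [mul_add (CS * ENNReal.ofReal k), e2, e3, ek2, ek3, h𝒲ₜ, hM₁, hM₂, hM₃, hM₄, hcA, hcB, hcC, hcD, hcF, hα₁]
    ring
  have hK₁ : α₁ * CS * cB ≤ K₀ := by
    rw [hK₀]; exact le_add_right (le_add_right (le_add_right le_add_self))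
  have hK₂ : α₁ * cA + α₁ * CS * cC ≤ K₀ := by
    rw [hK₀]
    calc α₁ * cA + α₁ * CS * cC ≤ α₁ * cA + α₁ * CS * cB + α₁ * CS * cC :=
          add_le_add (le_self_add) le_rfl
      _ ≤ _ := le_add_right le_self_add
  have hK₃ : cF ≤ K₀ := by rw [hK₀]; exact le_add_self
  have hK₄ : cD ≤ K₀ := by rw [hK₀]; exact le_add_right le_add_self
  calc ∫⁻ y, f y ≤ _ := htot
    _ = (α₁ * CS * cB) * M₁ + (α₁ * cA + α₁ * CS * cC) * M₂ + cF * M₃ + cD * M₄ := hregroup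
    _ ≤ K₀ * M₁ + K₀ * M₂ + K₀ * M₃ + K₀ * M₄ :=
        add_le_add (add_le_add (add_le_add (mul_le_mul' hK₁ le_rfl) (mul_le_mul' hK₂ le_rfl))
          (mul_le_mul' hK₃ le_rfl)) (mul_le_mul' hK₄ le_rfl)
    _ = K₀ * (M₁ + M₂ + M₃ + M₄) := by ring

end Main

/-! ## The substitution `k = c^{-0.1}δ²`: discharge of `tao2011_nonlinearEstimate` -/

section Final

open scoped RealInnerProductSpace

/-- Powers of the slope `k = c^{-1/10}δ²`: `k^{3/2} = c^{-3/20}δ³`, `k^{-1/2} = c^{1/20}δ⁻¹`,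
`k^{5/2} = c^{-1/4}δ⁵`. [folklore] -/
theorem slope_rpow {c δ : ℝ} (hc : 0 < c) (hδ : 0 < δ) :
    (c ^ (-(1 / 10 : ℝ)) * δ ^ 2) ^ (3 / 2 : ℝ) = c ^ (-(3 / 20 : ℝ)) * δ ^ 3 ∧
      (c ^ (-(1 / 10 : ℝ)) * δ ^ 2) ^ (-(1 / 2) : ℝ) = c ^ (1 / 20 : ℝ) * δ⁻¹ ∧
      (c ^ (-(1 / 10 : ℝ)) * δ ^ 2) ^ (5 / 2 : ℝ) = c ^ (-(1 / 4) : ℝ) * δ ^ 5 := by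
  have hc' : 0 < c ^ (-(1 / 10 : ℝ)) := Real.rpow_pos_of_pos hc _
  have hδ2 : δ ^ 2 = δ ^ (2 : ℝ) := by norm_cast
  have key : ∀ s : ℝ, (c ^ (-(1 / 10 : ℝ)) * δ ^ 2) ^ s = c ^ (-(1 / 10 : ℝ) * s) * δ ^ (2 * s) := fun s => by
    rw [Real.mul_rpow hc'.le (by positivity), ← Real.rpow_mul hc.le, hδ2, ← Real.rpow_mul hδ.le]
  refine ⟨?_, ?_, ?_⟩
  · rw [key, show δ ^ 3 = δ ^ (3 : ℝ) by norm_cast]; norm_num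
  · rw [key, ← Real.rpow_neg_one δ]; norm_num
  · rw [key, show δ ^ 5 = δ ^ (5 : ℝ) by norm_cast]; norm_num


/-- **Tao 2011, proof of Thm. 10.1: the nonlinear estimate for `Y₆` — discharged.** The named fact
`tao2011_nonlinearEstimate` (`TaoNonlinearEstimate.lean`; Tao: "`Y₆,₁ ≲ c^{-0.15}δ³W^{3/2} +
c^{0.05}δ⁻¹W^{1/2}Y₁`", "`Y₆,₂ ≲ c^{0.9}Y₂ + c^{0.75}W/T`", arXiv pp. 32–33) follows from the
generic-slope estimate `Y6.lintegral_Y6_le` by the substitution `k = c^{-1/10}δ²`, the smallness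
(10.2) `δ⁵E^{1/2}T ≤ c` and `c ≤ c^{9/10}` (`0 < c ≤ 1`). [cite: Tao2011, §10, proof of Thm. 10.1 ((10.19)–(10.24)) + Remark 10.6] -/
theorem exists_tao2011_nonlinearEstimateWith : ∃ K : ℝ, 0 < K ∧ tao2011_nonlinearEstimateWith K := by
  obtain ⟨K₀, hK₀top, hY6⟩ := lintegral_Y6_le
  set K₀r := K₀.toReal with hK₀r
  have hK₀r0 : 0 ≤ K₀r := ENNReal.toReal_nonneg
  refine ⟨3 * K₀r + 1, by positivity, ?_⟩
  intro c δ T E hc hc1 hδ hT hE hsmall u hu hdiv hL2 hL2i s hs x₀ a b ha hab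
  set k := c ^ (-(1 / 10 : ℝ)) * δ ^ 2 with hk
  have hk0 : 0 < k := by positivity
  have hs0 : 0 ≤ s := (norm_nonneg _).trans (hs x₀)
  have hu4 : ContDiff ℝ 4 u := hu.of_le (WithTop.coe_le_coe.2 le_top)
  have hu1 : ContDiff ℝ 1 u := hu4.of_le (by norm_cast)
  have hω2 : ContDiff ℝ 2 (curl u) := contDiff_curl (n := 2) (hu4.of_le (by norm_cast))
  have hω1 : ContDiff ℝ 1 (curl u) := hω2.of_le (by norm_cast)
  have hωc : Continuous (curl u) := hω1.continuous
  have hDωc : Continuous (fderiv ℝ (curl u)) := hω1.continuous_fderiv one_ne_zero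
  have hDuc : Continuous (fderiv ℝ u) := hu1.continuous_fderiv one_ne_zero
  have h := hY6 (x₀ := x₀) ha hk0 hab hu4 hdiv hs0 hs
  -- the weight
  set η : ℝ³ → ℝ := fun x => annularRamp k a b ‖x - x₀‖ with hη
  have hηc : Continuous η := (continuous_annularRamp hk0.le a b).comp (continuous_id.sub continuous_const).norm
  have hη0 : ∀ x, 0 ≤ η x := fun x => annularRamp_nonneg _ _ _ _
  have hηsupp : ∀ x, x ∉ closedBall x₀ b → η x = 0 := fun x hx => by
    rw [mem_closedBall, dist_eq_norm, not_le] at hx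
    exact annularRamp_eq_zero_of_outer_le hk0.le hx.le
  have hηcs : HasCompactSupport η := HasCompactSupport.intro (isCompact_closedBall x₀ b) hηsupp
  set W := localisedEnstrophy η u with hW
  set Y₁ := localisedEnstrophyDissipation η u with hY₁
  have hW0 : 0 ≤ W := localisedEnstrophy_nonneg hη0 u
  have hY₁0 : 0 ≤ Y₁ := localisedEnstrophyDissipation_nonneg hη0 u
  set L : Set ℝ³ := {y : ℝ³ | (a < ‖y - x₀‖ ∧ ‖y - x₀‖ < a + k⁻¹) ∨ (b - k⁻¹ < ‖y - x₀‖ ∧ ‖y - x₀‖ < b)} with hL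
  set Λr := ∫ y in L, ‖curl u y‖ ^ 2 with hΛr
  have hΛr0 : 0 ≤ Λr := integral_nonneg fun _ => sq_nonneg _
  -- (1) the global quantities in real form
  have hI1 : Integrable fun y => ‖curl u y‖ ^ 2 * η y :=
    ((hωc.norm.pow 2).mul hηc).integrable_of_hasCompactSupport hηcs.mul_left
  have e𝒲 : ∫⁻ y, ‖curl u y‖ₑ ^ 2 * ENNReal.ofReal (η y) = ENNReal.ofReal (2 * W) := by
    rw [hW, localisedEnstrophy_def, ← mul_assoc, show (2 : ℝ) * (1 / 2) = 1 by norm_num, one_mul,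
      ofReal_integral_eq_lintegral_ofReal hI1 (Eventually.of_forall fun y => mul_nonneg (sq_nonneg _) (hη0 y))]
    refine lintegral_congr fun y => ?_
    rw [ENNReal.ofReal_mul (sq_nonneg _), ← ofReal_norm, ENNReal.ofReal_pow (norm_nonneg _)]
  have hI2 : Integrable fun y => frobeniusNormSq (fderiv ℝ (curl u) y) * η y :=
    ((continuous_frobeniusNormSq_fderiv hω2 (by norm_num)).mul hηc).integrable_of_hasCompactSupport hηcs.mul_left
  have h𝒴 : ∫⁻ y, ‖fderiv ℝ (curl u) y‖ₑ ^ 2 * ENNReal.ofReal (η y) ≤ ENNReal.ofReal Y₁ := by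
    rw [hY₁, localisedEnstrophyDissipation_def, ofReal_integral_eq_lintegral_ofReal hI2
      (Eventually.of_forall fun y => mul_nonneg (frobeniusNormSq_nonneg _) (hη0 y))]
    refine lintegral_mono fun y => ?_
    rw [ENNReal.ofReal_mul (frobeniusNormSq_nonneg _), ← ofReal_norm, ← ENNReal.ofReal_pow (norm_nonneg _)]
    exact mul_le_mul' (ENNReal.ofReal_le_ofReal (sq_opNorm_le_frobeniusNormSq _)) le_rfl
  have e𝒰 : (∫⁻ w, ‖u w‖ₑ ^ 2) ≤ ENNReal.ofReal (2 * E) := by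
    rw [show (∫⁻ w, ‖u w‖ₑ ^ 2) = ∫⁻ w, ENNReal.ofReal (‖u w‖ ^ 2) from lintegral_congr fun w => by
      rw [← ofReal_norm, ENNReal.ofReal_pow (norm_nonneg _)],
      ← ofReal_integral_eq_lintegral_ofReal hL2i (Eventually.of_forall fun w => sq_nonneg _)]
    exact ENNReal.ofReal_le_ofReal hL2
  have h𝒰 : (∫⁻ w, ‖u w‖ₑ ^ 2) ^ (1 / 2 : ℝ) ≤ ENNReal.ofReal (Real.sqrt (2 * E)) := by
    rw [Real.sqrt_eq_rpow, ← ENNReal.ofReal_rpow_of_nonneg (by positivity) (by norm_num)]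
    exact ENNReal.rpow_le_rpow e𝒰 (by norm_num)
  have hLb : L ⊆ ball x₀ b := fun y hy => by
    rw [mem_ball, dist_eq_norm]
    rcases hy with ⟨_, h2⟩ | ⟨_, h2⟩
    · have : 0 < k⁻¹ := inv_pos.2 hk0; linarith
    · exact h2
  have hI4 : IntegrableOn (fun y => ‖curl u y‖ ^ 2) L :=
    (integrableOn_ball_of_continuous (hωc.norm.pow 2) x₀ b).mono_set hLb
  have eΛ : ∫⁻ y in L, ‖curl u y‖ₑ ^ 2 = ENNReal.ofReal Λr := by
    rw [hΛr, ofReal_integral_eq_lintegral_ofReal hI4 (Eventually.of_forall fun y => sq_nonneg _)]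
    refine lintegral_congr fun y => ?_
    rw [← ofReal_norm, ENNReal.ofReal_pow (norm_nonneg _)]
  -- (2) the right-hand side is at most `ofReal (K₀r (m₁ + m₂ + m₃ + m₄))`
  set m₁ : ℝ := k ^ (3 / 2 : ℝ) * Real.sqrt (2 * W) * (2 * W) with hm₁
  set m₂ : ℝ := k ^ (-(1 / 2) : ℝ) * Real.sqrt (2 * W) * Y₁ with hm₂
  set m₃ : ℝ := k ^ (5 / 2 : ℝ) * Real.sqrt (2 * E) * (2 * W) with hm₃
  set m₄ : ℝ := k * s * Λr with hm₄
  have hm₁0 : 0 ≤ m₁ := by positivity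
  have hm₂0 : 0 ≤ m₂ := by positivity
  have hm₃0 : 0 ≤ m₃ := by positivity
  have hm₄0 : 0 ≤ m₄ := by positivity
  have e𝒲2 : (∫⁻ y, ‖curl u y‖ₑ ^ 2 * ENNReal.ofReal (η y)) ^ (1 / 2 : ℝ) = ENNReal.ofReal (Real.sqrt (2 * W)) := by
    rw [e𝒲, ENNReal.ofReal_rpow_of_nonneg (by positivity) (by norm_num), Real.sqrt_eq_rpow]
  have hRHS : K₀ * (ENNReal.ofReal (k ^ (3 / 2 : ℝ)) *
        (∫⁻ y, ‖curl u y‖ₑ ^ 2 * ENNReal.ofReal (η y)) ^ (1 / 2 : ℝ) *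
          (∫⁻ y, ‖curl u y‖ₑ ^ 2 * ENNReal.ofReal (η y)) +
      ENNReal.ofReal (k ^ (-(1 / 2) : ℝ)) * (∫⁻ y, ‖curl u y‖ₑ ^ 2 * ENNReal.ofReal (η y)) ^ (1 / 2 : ℝ) *
          (∫⁻ y, ‖fderiv ℝ (curl u) y‖ₑ ^ 2 * ENNReal.ofReal (η y)) +
      ENNReal.ofReal (k ^ (5 / 2 : ℝ)) * (∫⁻ w, ‖u w‖ₑ ^ 2) ^ (1 / 2 : ℝ) *
          (∫⁻ y, ‖curl u y‖ₑ ^ 2 * ENNReal.ofReal (η y)) +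
      ENNReal.ofReal (k * s) * ∫⁻ y in L, ‖curl u y‖ₑ ^ 2) ≤
      ENNReal.ofReal (K₀r * (m₁ + m₂ + m₃ + m₄)) := by
    have eK : K₀ = ENNReal.ofReal K₀r := by rw [hK₀r, ENNReal.ofReal_toReal hK₀top]
    rw [e𝒲2, e𝒲, eΛ, ENNReal.ofReal_mul hK₀r0, eK,
      ENNReal.ofReal_add (add_nonneg (add_nonneg hm₁0 hm₂0) hm₃0) hm₄0,
      ENNReal.ofReal_add (add_nonneg hm₁0 hm₂0) hm₃0, ENNReal.ofReal_add hm₁0 hm₂0]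
    have e1 : ENNReal.ofReal m₁ = ENNReal.ofReal (k ^ (3 / 2 : ℝ)) * ENNReal.ofReal (Real.sqrt (2 * W)) *
        ENNReal.ofReal (2 * W) := by
      rw [hm₁, ← ENNReal.ofReal_mul (by positivity), ← ENNReal.ofReal_mul (by positivity)]
    have e2 : ENNReal.ofReal m₂ = ENNReal.ofReal (k ^ (-(1 / 2) : ℝ)) * ENNReal.ofReal (Real.sqrt (2 * W)) *
        ENNReal.ofReal Y₁ := by
      rw [hm₂, ← ENNReal.ofReal_mul (by positivity), ← ENNReal.ofReal_mul (by positivity)]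
    have e3 : ENNReal.ofReal m₃ = ENNReal.ofReal (k ^ (5 / 2 : ℝ)) * ENNReal.ofReal (Real.sqrt (2 * E)) *
        ENNReal.ofReal (2 * W) := by
      rw [hm₃, ← ENNReal.ofReal_mul (by positivity), ← ENNReal.ofReal_mul (by positivity)]
    have e4 : ENNReal.ofReal m₄ = ENNReal.ofReal (k * s) * ENNReal.ofReal Λr := by
      rw [hm₄, ← ENNReal.ofReal_mul (by positivity)]
    rw [e1, e2, e3, e4]
    refine mul_le_mul' le_rfl (add_le_add (add_le_add (add_le_add le_rfl ?_) ?_) le_rfl)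
    · exact mul_le_mul' le_rfl h𝒴
    · exact mul_le_mul' (mul_le_mul' le_rfl h𝒰) le_rfl
  -- (3) the left-hand side
  set φ : ℝ³ → ℝ := fun x => ⟪curl u x, convect (curl u) u x⟫ * η x with hφ
  have hφm : AEStronglyMeasurable φ volume :=
    (((hωc.inner (hDuc.clm_apply hωc)).mul hηc)).aestronglyMeasurable
  have hφpt : ∀ x, ‖φ x‖ₑ ≤ ‖curl u x‖ₑ ^ 2 * ‖fderiv ℝ u x‖ₑ * ENNReal.ofReal (η x) := by
    intro x
    rw [← ofReal_norm, ← ofReal_norm, ← ofReal_norm, ← ENNReal.ofReal_pow (norm_nonneg _),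
      ← ENNReal.ofReal_mul (by positivity), ← ENNReal.ofReal_mul (by positivity)]
    refine ENNReal.ofReal_le_ofReal ?_
    rw [hφ, norm_mul, Real.norm_of_nonneg (hη0 x), convect_apply]
    refine mul_le_mul_of_nonneg_right ?_ (hη0 x)
    calc ‖⟪curl u x, fderiv ℝ u x (curl u x)⟫‖ ≤ ‖curl u x‖ * ‖fderiv ℝ u x (curl u x)‖ := norm_inner_le_norm _ _
      _ ≤ ‖curl u x‖ * (‖fderiv ℝ u x‖ * ‖curl u x‖) :=
          mul_le_mul_of_nonneg_left (ContinuousLinearMap.le_opNorm _ _) (norm_nonneg _)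
      _ = ‖curl u x‖ ^ 2 * ‖fderiv ℝ u x‖ := by ring
  have hLHS : |∫ x, φ x| ≤ K₀r * (m₁ + m₂ + m₃ + m₄) := by
    calc |∫ x, φ x| = ‖∫ x, φ x‖ := (Real.norm_eq_abs _).symm
      _ ≤ ∫ x, ‖φ x‖ := norm_integral_le_integral_norm _
      _ = (∫⁻ x, ‖φ x‖ₑ).toReal := integral_norm_eq_lintegral_enorm hφm
      _ ≤ (ENNReal.ofReal (K₀r * (m₁ + m₂ + m₃ + m₄))).toReal :=
          ENNReal.toReal_mono ENNReal.ofReal_ne_top (((lintegral_mono hφpt).trans h).trans hRHS)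
      _ = K₀r * (m₁ + m₂ + m₃ + m₄) := ENNReal.toReal_ofReal (by positivity)
  -- (4) the substitution
  obtain ⟨ek3, ek1, ek5⟩ := slope_rpow hc hδ
  rw [← hk] at ek3 ek1 ek5
  have hsq2 : Real.sqrt (2 * W) = Real.sqrt 2 * Real.sqrt W := Real.sqrt_mul (by norm_num) W
  have hsq2E : Real.sqrt (2 * E) = Real.sqrt 2 * Real.sqrt E := Real.sqrt_mul (by norm_num) E
  have h22 : Real.sqrt 2 ≤ 3 / 2 := by
    rw [show (3 / 2 : ℝ) = Real.sqrt ((3 / 2) ^ 2) by rw [Real.sqrt_sq (by norm_num)]]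
    exact Real.sqrt_le_sqrt (by norm_num)
  have hs2 : 0 ≤ Real.sqrt 2 := Real.sqrt_nonneg _
  -- m₁
  have b₁ : K₀r * m₁ ≤ (3 * K₀r + 1) * (c ^ (-(3 / 20 : ℝ)) * δ ^ 3 * (W * Real.sqrt W)) := by
    rw [hm₁, ek3, hsq2]
    have hX : 0 ≤ c ^ (-(3 / 20 : ℝ)) * δ ^ 3 * (W * Real.sqrt W) := by positivity
    calc K₀r * (c ^ (-(3 / 20 : ℝ)) * δ ^ 3 * (Real.sqrt 2 * Real.sqrt W) * (2 * W))
        = (2 * Real.sqrt 2 * K₀r) * (c ^ (-(3 / 20 : ℝ)) * δ ^ 3 * (W * Real.sqrt W)) := by ring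
      _ ≤ (3 * K₀r + 1) * (c ^ (-(3 / 20 : ℝ)) * δ ^ 3 * (W * Real.sqrt W)) := by
          refine mul_le_mul_of_nonneg_right ?_ hX
          nlinarith only [h22, hK₀r0, hs2]
  -- m₂
  have b₂ : K₀r * m₂ ≤ (3 * K₀r + 1) * (c ^ (1 / 20 : ℝ) * δ⁻¹ * (Real.sqrt W * Y₁)) := by
    rw [hm₂, ek1, hsq2]
    have hX : 0 ≤ c ^ (1 / 20 : ℝ) * δ⁻¹ * (Real.sqrt W * Y₁) := by positivity
    calc K₀r * (c ^ (1 / 20 : ℝ) * δ⁻¹ * (Real.sqrt 2 * Real.sqrt W) * Y₁)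
        = (Real.sqrt 2 * K₀r) * (c ^ (1 / 20 : ℝ) * δ⁻¹ * (Real.sqrt W * Y₁)) := by ring
      _ ≤ (3 * K₀r + 1) * (c ^ (1 / 20 : ℝ) * δ⁻¹ * (Real.sqrt W * Y₁)) := by
          refine mul_le_mul_of_nonneg_right ?_ hX
          nlinarith only [h22, hK₀r0, hs2]
  -- m₃: use (10.2)
  have b₃ : K₀r * m₃ ≤ (3 * K₀r + 1) * (c ^ (3 / 4 : ℝ) * W / T) := by
    rw [hm₃, ek5, hsq2E]
    have hδE : δ ^ 5 * Real.sqrt E ≤ c / T := by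
      rw [le_div_iff₀ hT]; linarith
    have hc34 : c ^ (-(1 / 4) : ℝ) * c = c ^ (3 / 4 : ℝ) := by
      rw [show c ^ (-(1 / 4) : ℝ) * c = c ^ (-(1 / 4) : ℝ) * c ^ (1 : ℝ) by rw [Real.rpow_one], ← Real.rpow_add hc]
      norm_num
    have hX : 0 ≤ c ^ (-(1 / 4) : ℝ) * W := by positivity
    calc K₀r * (c ^ (-(1 / 4) : ℝ) * δ ^ 5 * (Real.sqrt 2 * Real.sqrt E) * (2 * W))
        = (2 * Real.sqrt 2 * K₀r) * (δ ^ 5 * Real.sqrt E) * (c ^ (-(1 / 4) : ℝ) * W) := by ring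
      _ ≤ (3 * K₀r + 1) * (c / T) * (c ^ (-(1 / 4) : ℝ) * W) := by
          refine mul_le_mul (mul_le_mul (by nlinarith only [h22, hK₀r0, hs2]) hδE (by positivity)
            (by positivity)) le_rfl hX (by positivity)
      _ = (3 * K₀r + 1) * ((c ^ (-(1 / 4) : ℝ) * c) * W / T) := by ring
      _ = _ := by rw [hc34]
  -- m₄: `c ≤ c^{9/10}`
  have b₄ : K₀r * m₄ ≤ (3 * K₀r + 1) * c ^ (9 / 10 : ℝ) * (k / (2 * c) * s * Λr) := by
    rw [hm₄]
    have hc9 : c ≤ c ^ (9 / 10 : ℝ) := by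
      conv_lhs => rw [← Real.rpow_one c]
      exact Real.rpow_le_rpow_of_exponent_ge hc hc1 (by norm_num)
    have hX : 0 ≤ k / (2 * c) * s * Λr := by positivity
    have e4 : K₀r * (k * s * Λr) = (2 * K₀r) * c * (k / (2 * c) * s * Λr) := by
      field_simp
    calc K₀r * (k * s * Λr) = (2 * K₀r) * c * (k / (2 * c) * s * Λr) := e4
      _ ≤ (3 * K₀r + 1) * c ^ (9 / 10 : ℝ) * (k / (2 * c) * s * Λr) := by
          refine mul_le_mul_of_nonneg_right (mul_le_mul (by linarith only [hK₀r0]) hc9 hc.le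
            (by positivity)) hX
  calc |∫ x, φ x| ≤ K₀r * (m₁ + m₂ + m₃ + m₄) := hLHS
    _ = K₀r * m₁ + K₀r * m₂ + K₀r * m₃ + K₀r * m₄ := by ring
    _ ≤ (3 * K₀r + 1) * (c ^ (-(3 / 20 : ℝ)) * δ ^ 3 * (W * Real.sqrt W)) +
        (3 * K₀r + 1) * (c ^ (1 / 20 : ℝ) * δ⁻¹ * (Real.sqrt W * Y₁)) +
        (3 * K₀r + 1) * (c ^ (3 / 4 : ℝ) * W / T) +
        (3 * K₀r + 1) * c ^ (9 / 10 : ℝ) * (k / (2 * c) * s * Λr) := add_le_add (add_le_add (add_le_add b₁ b₂) b₃) b₄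
    _ = _ := by ring

end Final

end Y6

/-- Local notation for physical space. -/
local notation "ℝ³" => EuclideanSpace ℝ (Fin 3)

/-- **Tao 2011, §10: the nonlinear estimate for `Y₆` is a theorem** (discharge of the named fact
`tao2011_nonlinearEstimate` of `TaoNonlinearEstimate.lean`). [cite: Tao2011, §10, proof of Thm. 10.1 ((10.19)–(10.24)) + Remark 10.6] -/
theorem tao2011_nonlinearEstimate_holds : tao2011_nonlinearEstimate :=
  Y6.exists_tao2011_nonlinearEstimateWith

/-- **Tao 2011, Thm. 10.1 (Enstrophy localisation) in the exterior form of Remark 10.6, a priori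
form — a theorem** (discharge of `tao2011_enstrophyLocalisation_exterior_apriori`,
`TaoEnstrophyLocalisationParts.lean`, through the tree's assembly
`tao2011_enstrophyLocalisation_exterior_apriori_of_nonlinearEstimate`). [cite: Tao2011, Thm. 10.1 (proof, §10) + Remark 10.6] -/
theorem tao2011_enstrophyLocalisation_exterior_apriori_holds :
    tao2011_enstrophyLocalisation_exterior_apriori :=
  tao2011_enstrophyLocalisation_exterior_apriori_of_nonlinearEstimate tao2011_nonlinearEstimate_holds

end Literature.Analysis.FluidPDE

end
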